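import Literature.Probability.FitznerVanDerHofstad2017.SrwIntegralBounds
import Mathlib.Analysis.SpecialFunctions.ImproperIntegrals
import Mathlib.Analysis.SpecialFunctions.Gamma.Basic
import Mathlib.Analysis.SpecialFunctions.Trigonometric.Bounds
import Mathlib.MeasureTheory.Integral.Prod
import Literature.Analysis.FunctionSpaces.BesselJPoissonIntegral
import Mathlib.MeasureTheory.Integral.Pi
import Mathlib.Analysis.Complex.Trigonometric
import Literature.Analysis.FunctionSpaces.BesselJLargeArgument
import HarnessLib

/-!
# The absolute value as an integrated cosine defect: `∫ F·|ξ| = (2/π) ∫₀^∞ (∫ F (1 - cos βξ)) β⁻² dβ`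

CITATION HEADER (PLACEMENT v2). This module is part of a certified REPRODUCTION of:
R. Fitzner, R. van der Hofstad, *Generalized approach to the non-backtracking lace expansion*,
Probab. Theory Related Fields 169 (2017) 1041–1119 [NoBLE17] (arXiv:1506.07969), §3.3.3 and §5,
as consumed by *Mean-field behavior for nearest-neighbor percolation in d > 10*, Electron. J.
Probab. 22 (2017) no. 43 [FvdH17]. It supplies, d-generically and with no numerical content, the
classical identity behind the *characteristic-function device* used to evaluate the SRW integrals
`K_{n,l}(x) = ∫ |D̂|^l Ĉⁿ |D̂^{(x)}| dk/(2π)^d` of [NoBLE17, (3.36)] without Monte-Carlo or cubature: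
the absolute value `|D̂^{(x)}(k)|` is traded for the oscillatory weights `cos (β D̂^{(x)}(k))`, whose
cube integrals factorise over coordinates (products of Bessel functions) and are computable in
closed form.

## Contents

* `integral_Ioi_one_sub_cos_div_sq` — `∫₀^∞ (1 - cos u) u⁻² du = π/2`, i.e. the Fejér kernel of the
  real line `K(x) = (2π)⁻¹ (sin (x/2) / (x/2))² = π⁻¹ (1 - cos x)/x²` has total mass one
  (Katznelson, *An Introduction to Harmonic Analysis*, Ch. VI §1.9). The proof given here is
  self-contained: `u⁻² = ∫₀^∞ t e^{-ut} dt`, Tonelli, `∫₀^∞ (1 - cos u) e^{-tu} du = 1/t - t/(1+t²)`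
  and `∫₀^∞ dt/(1+t²) = π/2`.
* `abs_eq_integral_one_sub_cos_div_sq` — `|q| = (2/π) ∫₀^∞ (1 - cos (βq)) β⁻² dβ` (scaling).
* `integral_mul_abs_eq_integral_cosDefect` — for a finite measure `μ`, an integrable `F` and an
  a.e.-bounded measurable `ξ`: `∫ F |ξ| dμ = (2/π) ∫₀^∞ (∫ F (1 - cos (β ξ)) dμ) β⁻² dβ` (Fubini,
  dominated by `|F| · min (2β⁻², B²/2)`).
* `integral_mul_abs_eq_integral_cosDefect_scaled` — the same with phase `β c ξ` and prefactor
  `2/(πc)`, `c > 0`.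
* `srwK_eq_integral_cosDefect`, `srwK_eq_integral_cosDefect_scaled` — the instance `F = |D̂|^l Ĉⁿ`,
  `ξ = D̂^{(x)}` on the cube `([-π,π]^d, P d)` for `d ≥ 2n + 1`:
  `K_{n,l}(x) = (2/π) ∫₀^∞ β⁻² (∫ |D̂|^l (1 - cos (β D̂^{(x)})) Ĉⁿ dk/(2π)^d) dβ`
  `= (2/(πd)) ∫₀^∞ β⁻² (∫ |D̂|^l (1 - cos (β d D̂^{(x)})) Ĉⁿ dk/(2π)^d) dβ`.

LANE. d-generic support (input certification for a future kernel quadrature of the device); no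
number at any `d` is produced or altered.

## References

* [Katznelson2004] Y. Katznelson, *An Introduction to Harmonic Analysis*, 3rd ed., Cambridge 2004,
  Ch. VI §1.8–§1.9 (the Fejér kernel on `ℝ`, `∫ K = 1`), held copy PDF pp. 153–154.
* [FitznerVanDerHofstad2016NoBLE] (3.34)–(3.36) p. 1071 (the integrals `D̂^{(x)}`, `K_{n,l}(x)`).
* [HeydenreichVanDerHofstad2017] Prop. 5.5 (integrability of `Ĉⁿ` on the cube for `d > 2n`).
* [DLMF] 10.9.1–10.9.2 (Bessel's / Poisson's integral for `J₀`), used in Part II.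

## Part II (section `CharFun`) — the characteristic function of `D̂` on the cube is `J₀^d`; `κ_d = ∫|D̂|` as a Bessel integral

Simple random walk on `ℤ^d`, Fourier side: `D̂(k) = d⁻¹ Σ_j cos k_j` on the cube `[-π,π]^d`
with Lebesgue measure `P d = μI^{⊗ d}` (`Slade2006Prop53.P`).

* `integral_cos_mul_cos_μI`, `integral_sin_mul_cos_μI`, `integral_cexp_mul_cos_μI`:
  Bessel's integral in the form `∫_{-π}^{π} e^{i y cos k} dk = 2π J₀(y)` (real part
  `2π J₀(y)` from the tree's Poisson integral `integral_cos_mul_cos_eq_pi_mul_besselJ_zero`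
  and evenness; imaginary part `0` by `k ↦ k - π`), DLMF 10.9.1–10.9.2.
* `integral_cexp_mul_sum_cos_P`, `integral_cos_mul_sum_cos_P`, `integral_cos_mul_Dhat_P`:
  `∫_{[-π,π]^d} e^{iβ Σ_j cos k_j} dk = (2π J₀(β))^d` — the coordinates factorise
  (`MeasureTheory.integral_fintype_prod_eq_prod`) — and its real part
  `∫ cos(β d D̂(k)) dk = (2π J₀(β))^d`; `integral_one_P : ∫ 1 dk = (2π)^d`,
  `integral_one_sub_cos_mul_Dhat_P : ∫ (1 - cos(β d D̂)) dk = (2π)^d (1 - J₀(β)^d)`.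
* `integral_abs_Dhat_div_eq_integral_besselJ` (`d ≥ 1`):
  `κ_d := ∫_{[-π,π]^d} |D̂(k)| dk/(2π)^d = (2/(πd)) ∫₀^∞ (1 - J₀(β)^d) β⁻² dβ`,
  from the scaled cosine-defect (Fejér-kernel) representation of `|·|`
  (`integral_mul_abs_eq_integral_cosDefect_scaled` of Part I, `F = 1`, `ξ = D̂`,
  `c = d`) and the closed form of the inner integral; packaged for the NoBLE integral
  `K_{0,0}(e_i)` ((3.36)) as `srwK_zero_zero_single_eq_integral_besselJ`.

The point of the last identity: a `d`-dimensional integral with the non-smooth weight `|D̂|`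
becomes a one-dimensional integral of the entire, bounded integrand `(1 - J₀(β)^d)/β²`
(`|J₀| ≤ 1`), which is what a certified one-dimensional quadrature can enclose. Everything is
`d`-generic; no numerical value is asserted.

## Part III (sections `KappaTail`, `KappaCorollary`) — the Bessel integral `∫₀^∞ (1 - J₀(β)^d) β⁻² dβ`: integrability, sign, an explicit truncation bracket, and the resulting `κ_d` bracket

Part III (d-generic; no numerical value at any `d`) serves the leaf KU-CF-ENCL / KAPPA-TAIL of the b2b-lace LEMMAS DAG
(kernel enclosure of `κ_d = ∫_{[-π,π]^d}|D̂(k)|dk/(2π)^d`, the `n = l = 0`, `x = e₁` atom of the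
`K_{n,l}(x)` family of [FvdH2017, (2.8)–(2.9)]), whose Bessel representation
`κ_d = (2/(πd)) ∫₀^∞ (1 - J₀(β)^d) β⁻² dβ` is `integral_abs_Dhat_div_eq_integral_besselJ` (module
`SrwAbsCosineDefect`, Part II).

Writing `f_d(β) := (1 - J₀(β)^d)/β²` and `η(B) := √(2/(πB)) + 17/B` (abbreviations of THIS DOCSTRING only — the
file introduces no definitions; every statement carries the explicit expressions
`(1 - besselJ 0 β ^ d) / β ^ 2` and `Real.sqrt (2 / (π * B)) + 17 / B`; the theorem names keep the mnemonic
`besselKappaIntegrand` = `f_d`, `hankelEta` = `η`), this file PROVES: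

* `one_sub_sq_div_four_le_besselJ_zero` — `J₀(β) ≥ 1 - β²/4` on `ℝ` (Poisson's integral + `cos y ≥ 1 - y²/2`);
* `besselKappaIntegrand_nonneg`, `…_le_div_four` (`≤ d/4`, via Bernoulli and `|J₀| ≤ 1`), `…_le_two_div_sq`,
  `measurable_…`, `continuous_…_on`, **`integrableOn_besselKappaIntegrand`** (integrable on `(0, ∞)`),
  `integral_Ioi_besselKappaIntegrand_nonneg`;
* `abs_besselJ_zero_le_hankelEta` — `|J₀(β)| ≤ η(B)` for `β ≥ B > 0`, from the tree's explicit Hankel bound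
  `abs_besselJ_sub_hankel_le` [Iwaniec2002, (B.35)];
* `integral_Ioi_besselKappaIntegrand_eq` (`∫_B^∞ = 1/B - ∫_B^∞ J₀^dβ⁻²`),
  `abs_integral_Ioi_besselJ_zero_pow_div_sq_le` (`|∫_B^∞ J₀^dβ⁻²| ≤ η(B)^d/B`),
  `integral_Ioi_besselKappaIntegrand_eq_add` (`∫₀^∞ = ∫₀^B + ∫_B^∞`);
* **`abs_integral_Ioi_besselKappaIntegrand_sub_le`** — THE BRACKET
  `|∫₀^∞ (1 - J₀^d)β⁻² - (∫_{(0,B]} (1 - J₀^d)β⁻² + 1/B)| ≤ η(B)^d/B`, plus the one-sided forms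
  `integral_Ioc_besselKappaIntegrand_le` (`∫₀^B ≤ ∫₀^∞`, all `d`) and
  `integral_Ioi_besselKappaIntegrand_le_of_even` (`∫₀^∞ ≤ ∫₀^B + 1/B`, even `d`).

So a kernel enclosure of `κ_d` reduces to enclosing the finite-range integral `∫₀^B` of a bounded entire integrand
(interval quadrature) — the tail is `1/B` up to `η(B)^d/B = O(B^{-1-d/2})`.

LANE / USAGE BOUNDARY: what-if / input-certification support only; no number at any `d`; the census functionals,
the record (CERT REV 14), the frame table and VERDICT-D10 are untouched.

## References
* [FitznerVanDerHofstad2016NoBLE] R. Fitzner, R. van der Hofstad, *Mean-field behavior for nearest-neighbor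
  percolation in `d > 10`*, EJP 22 (2017), §5.1.1 (5.2)–(5.4) (Bessel representations of the SRW integrals used for
  the rigorous numerics).
* [Iwaniec2002] H. Iwaniec, *Spectral Methods of Automorphic Forms*, GSM 53, Appendix B.4 (B.35), PDF p. 205.
* [AndrewsAskeyRoy1999] Andrews–Askey–Roy, *Special Functions*, §4.9 (4.9.12) (Poisson's integral for `J₀`).
* [DLMF] NIST DLMF 10.14.1 (`|J₀(x)| ≤ 1`).
* [Watson1944] G. N. Watson, *Bessel Functions*, §2.11 (continuity / analyticity of `J_n`).

Tree: `besselJ`, `besselJ_zero_eq_integral_cos_mul_cos` (`BesselJPoissonIntegral`), `abs_besselJ_zero_le_one_holds`,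
`continuous_besselJ_holds` (`BesselJProofs`), `abs_besselJ_sub_hankel_le` (`BesselJLargeArgument`).
Mathlib: `Real.one_sub_sq_div_two_le_cos`, `integral_cos_sq`, `one_add_mul_le_pow`, `integrableOn_Ioi_rpow_of_lt`,
`integral_Ioi_rpow_of_lt`, `setIntegral_union`, `setIntegral_mono_on`.

* `section KappaCorollary`: **`abs_integral_abs_Dhat_div_sub_le (hd : 0 < d) (hB : 0 < B)`** —
  `|∫|D̂(k)|dk/(2π)^d − (2/(πd))(∫_{(0,B]}(1−J₀^d)β⁻²dβ + 1/B)| ≤ (2/(πd))·η(B)^d/B` (Part II's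
  `integral_abs_Dhat_div_eq_integral_besselJ` + the bracket), and the same for the axis atom
  `srwK d 0 0 (Pi.single i 1)` (`abs_srwK_zero_zero_single_sub_le`): a kernel enclosure of `κ_d` IS an interval
  quadrature of the bounded entire integrand `(1−J₀(β)^d)β⁻²` on `(0, B]` plus `1/B`, with the explicit two-sided
  tail `η(B)^d/B`.
(Parts II–III were filed as extensions of this file rather than as separate modules because the hub's check farm could
not build oleans for newly landed modules on 2026-08-21; a later restructuring may move them to files of their own.)
-/

noncomputable section

open MeasureTheory Set Filter Real
open scoped Topology

namespace Literature.Probability.FitznerVanDerHofstad2017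

open Literature.Barriers.CriticalPhenomena
open Literature.Barriers.CriticalPhenomena.Slade2006Prop53 (P)

/-! ## One-dimensional integrals -/

/-- `∫₀^∞ dt/(1+t²) = π/2`. [folklore] -/
private theorem integral_Ioi_inv_one_add_sq_eq_pi_div_two :
    ∫ t in Ioi (0:ℝ), (1 + t ^ 2)⁻¹ = π / 2 := by
  have h := integral_Ioi_of_hasDerivAt_of_tendsto (f := Real.arctan) (f' := fun t : ℝ => (1 + t ^ 2)⁻¹)
    (a := 0) (m := π / 2) (Real.continuous_arctan.continuousWithinAt)
    (fun x _ => by simpa [one_div] using Real.hasDerivAt_arctan x)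
    (integrable_inv_one_add_sq.integrableOn)
    (Real.tendsto_arctan_atTop.mono_right nhdsWithin_le_nhds)
  rw [Real.arctan_zero, sub_zero] at h
  exact h

/-- `∫₀^∞ e^{-tu} du = 1/t` for `t > 0`. [folklore] -/
private theorem integral_Ioi_exp_neg_mul_eq {t : ℝ} (ht : 0 < t) :
    ∫ u in Ioi (0:ℝ), exp (-(t * u)) = 1 / t := by
  have h := MeasureTheory.integral_comp_mul_left_Ioi (fun v : ℝ => exp (-v)) (0:ℝ) ht
  simp only [mul_zero] at h
  rw [h, integral_exp_neg_Ioi_zero, smul_eq_mul, mul_one, one_div]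

/-- Integrability of `e^{-tu}` on `(0, ∞)` for `t > 0`. [folklore] -/
private theorem integrableOn_exp_neg_mul' {t : ℝ} (ht : 0 < t) :
    IntegrableOn (fun u : ℝ => exp (-(t * u))) (Ioi 0) := by
  simpa [neg_mul] using exp_neg_integrableOn_Ioi 0 ht

/-- Integrability of `cos u · e^{-tu}` on `(0, ∞)` for `t > 0`. [folklore] -/
private theorem integrableOn_cos_mul_exp_neg_mul {t : ℝ} (ht : 0 < t) :
    IntegrableOn (fun u : ℝ => cos u * exp (-(t * u))) (Ioi 0) := by
  refine (integrableOn_exp_neg_mul' ht).integrable.mono ?_ ?_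
  · exact (continuous_cos.mul (continuous_exp.comp (continuous_const.mul continuous_id).neg)).aestronglyMeasurable
  · refine ae_of_all _ fun u => ?_
    rw [norm_mul, Real.norm_eq_abs, Real.norm_eq_abs, abs_of_pos (exp_pos _)]
    exact mul_le_of_le_one_left (exp_pos _).le (abs_cos_le_one u)

/-- `∫₀^∞ cos u · e^{-tu} du = t/(1+t²)` for `t > 0` (antiderivative
`e^{-tu}(sin u - t cos u)/(1+t²)`). [folklore] -/
private theorem integral_Ioi_cos_mul_exp_neg_mul {t : ℝ} (ht : 0 < t) :
    ∫ u in Ioi (0:ℝ), cos u * exp (-(t * u)) = t / (1 + t ^ 2) := by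
  have h1t : (0:ℝ) < 1 + t ^ 2 := by positivity
  set F : ℝ → ℝ := fun u => exp (-(t * u)) * (sin u - t * cos u) / (1 + t ^ 2) with hF
  have hderiv : ∀ u : ℝ, HasDerivAt F (cos u * exp (-(t * u))) u := by
    intro u
    have he : HasDerivAt (fun u : ℝ => exp (-(t * u))) (exp (-(t * u)) * (-t)) u := by
      have := ((hasDerivAt_id u).const_mul t).neg.exp
      simpa using this
    have hs : HasDerivAt (fun u : ℝ => sin u - t * cos u) (cos u - t * (-sin u)) u :=
      (hasDerivAt_sin u).sub ((hasDerivAt_cos u).const_mul t)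
    have e : (rexp (-(t * u)) * -t * (sin u - t * cos u) + rexp (-(t * u)) * (cos u - t * -sin u))
        / (1 + t ^ 2) = cos u * exp (-(t * u)) := by
      rw [div_eq_iff h1t.ne']
      ring
    rw [hF]
    exact ((he.mul hs).div_const (1 + t ^ 2)).congr_deriv e
  have hcont : ContinuousWithinAt F (Ici 0) 0 := (hderiv 0).continuousAt.continuousWithinAt
  have hlim : Tendsto F atTop (𝓝 0) := by
    have h1 : Tendsto (fun u : ℝ => t * u) atTop atTop := tendsto_id.const_mul_atTop ht
    have he : Tendsto (fun u : ℝ => exp (-(t * u))) atTop (𝓝 0) :=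
      tendsto_exp_neg_atTop_nhds_zero.comp h1
    have hb : ∀ u, |F u| ≤ (1 + t) / (1 + t ^ 2) * exp (-(t * u)) := by
      intro u
      rw [hF]
      simp only
      rw [abs_div, abs_mul, abs_of_pos (exp_pos _), abs_of_pos h1t]
      have : |sin u - t * cos u| ≤ 1 + t := by
        calc |sin u - t * cos u| ≤ |sin u| + |t * cos u| := abs_sub _ _
          _ ≤ 1 + t * 1 := by
            rw [abs_mul, abs_of_pos ht]
            exact add_le_add (abs_sin_le_one u) (mul_le_mul_of_nonneg_left (abs_cos_le_one u) ht.le)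
          _ = 1 + t := by ring
      calc exp (-(t * u)) * |sin u - t * cos u| / (1 + t ^ 2)
          ≤ exp (-(t * u)) * (1 + t) / (1 + t ^ 2) := by gcongr
        _ = (1 + t) / (1 + t ^ 2) * exp (-(t * u)) := by ring
    have h0 : Tendsto (fun u : ℝ => (1 + t) / (1 + t ^ 2) * exp (-(t * u))) atTop (𝓝 0) := by
      simpa using he.const_mul ((1 + t) / (1 + t ^ 2))
    exact squeeze_zero_norm (fun u => by simpa [Real.norm_eq_abs] using hb u) h0
  have h := integral_Ioi_of_hasDerivAt_of_tendsto hcont (fun u _ => hderiv u)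
    (integrableOn_cos_mul_exp_neg_mul ht) hlim
  rw [h, hF]
  simp only [mul_zero, neg_zero, exp_zero, sin_zero, cos_zero, mul_one, one_mul, zero_sub]
  field_simp

/-- Integrability of `(1 - cos u) e^{-tu}` on `(0, ∞)` for `t > 0`. [folklore] -/
private theorem integrableOn_one_sub_cos_mul_exp_neg_mul {t : ℝ} (ht : 0 < t) :
    IntegrableOn (fun u : ℝ => (1 - cos u) * exp (-(t * u))) (Ioi 0) := by
  have e : (fun u : ℝ => (1 - cos u) * exp (-(t * u)))
      = fun u => exp (-(t * u)) - cos u * exp (-(t * u)) := by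
    funext u; ring
  rw [e]
  exact (integrableOn_exp_neg_mul' ht).sub (integrableOn_cos_mul_exp_neg_mul ht)

/-- `∫₀^∞ (1 - cos u) e^{-tu} du = 1/t - t/(1+t²)` for `t > 0`. [folklore] -/
private theorem integral_Ioi_one_sub_cos_mul_exp_neg_mul {t : ℝ} (ht : 0 < t) :
    ∫ u in Ioi (0:ℝ), (1 - cos u) * exp (-(t * u)) = 1 / t - t / (1 + t ^ 2) := by
  have e : (fun u : ℝ => (1 - cos u) * exp (-(t * u)))
      = fun u => exp (-(t * u)) - cos u * exp (-(t * u)) := by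
    funext u; ring
  rw [e, integral_sub (integrableOn_exp_neg_mul' ht) (integrableOn_cos_mul_exp_neg_mul ht),
    integral_Ioi_exp_neg_mul_eq ht, integral_Ioi_cos_mul_exp_neg_mul ht]

/-- `∫₀^∞ t e^{-ut} dt = 1/u²` for `u > 0` (Euler's integral for `Γ(2)`). [folklore] -/
private theorem integral_Ioi_mul_exp_neg_mul {u : ℝ} (hu : 0 < u) :
    ∫ t in Ioi (0:ℝ), t * exp (-(u * t)) = 1 / u ^ 2 := by
  have h := Real.integral_rpow_mul_exp_neg_mul_Ioi (a := 2) (r := u) (by norm_num) hu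
  have h' : ∫ t in Ioi (0:ℝ), t ^ ((2:ℝ) - 1) * exp (-(u * t))
      = ∫ t in Ioi (0:ℝ), t * exp (-(u * t)) := by
    refine setIntegral_congr_fun measurableSet_Ioi fun t _ => ?_
    have : (2:ℝ) - 1 = 1 := by norm_num
    simp [this]
  have hG2 : Real.Gamma 2 = 1 := by
    rw [show (2:ℝ) = (1:ℕ) + 1 by norm_num, Real.Gamma_nat_eq_factorial]
    simp
  rw [← h', h, hG2, mul_one, Real.rpow_two]
  field_simp

/-! ## The Fejér-kernel identity -/

/-- **`∫₀^∞ (1 - cos u) u⁻² du = π/2`**: the Fejér kernel of the line,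
`K(x) = (2π)⁻¹ (sin (x/2)/(x/2))² = (1 - cos x)/(π x²)`, has total mass one. (Proof here: insert
`u⁻² = ∫₀^∞ t e^{-ut} dt`, exchange the integrals (Tonelli, the integrand is nonnegative), and use
`∫₀^∞ (1 - cos u) e^{-tu} du = 1/t - t/(1+t²)`, `∫₀^∞ dt/(1+t²) = π/2`.)
[cite: Katznelson2004, Ch. VI §1.9 (1.8), p. 153–154] -/
theorem integral_Ioi_one_sub_cos_div_sq : ∫ u in Ioi (0:ℝ), (1 - cos u) / u ^ 2 = π / 2 := by
  set μ : Measure ℝ := volume.restrict (Ioi (0:ℝ)) with hμ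
  set f : ℝ → ℝ → ℝ := fun u t => (1 - cos u) * (t * exp (-(u * t))) with hf
  have step1 : ∫ u in Ioi (0:ℝ), (1 - cos u) / u ^ 2 = ∫ u, ∫ t, f u t ∂μ ∂μ := by
    rw [hμ]
    refine setIntegral_congr_fun measurableSet_Ioi fun u hu => ?_
    simp only [hf]
    rw [integral_const_mul, integral_Ioi_mul_exp_neg_mul hu]
    ring
  have step3 : ∀ t : ℝ, 0 < t → ∫ u, f u t ∂μ = (1 + t ^ 2)⁻¹ := by
    intro t ht
    have e : (fun u => f u t) = fun u => t * ((1 - cos u) * exp (-(t * u))) := by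
      funext u; simp only [hf]; rw [mul_comm u t]; ring
    rw [e, integral_const_mul, hμ, integral_Ioi_one_sub_cos_mul_exp_neg_mul ht]
    field_simp
    ring
  have hf_nonneg : ∀ u t : ℝ, 0 ≤ t → 0 ≤ f u t := by
    intro u t ht
    simp only [hf]
    have : 0 ≤ 1 - cos u := by linarith [cos_le_one u]
    positivity
  have hsec : ∀ t : ℝ, 0 < t → Integrable (fun u => f u t) μ := by
    intro t ht
    have e : (fun u => f u t) = fun u => t * ((1 - cos u) * exp (-(t * u))) := by
      funext u; simp only [hf]; rw [mul_comm u t]; ring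
    rw [e, hμ]
    exact (integrableOn_one_sub_cos_mul_exp_neg_mul ht).integrable.const_mul t
  have hcont : Continuous (Function.uncurry f) := by
    simp only [hf]
    fun_prop
  have hint : Integrable (Function.uncurry f) (μ.prod μ) := by
    rw [MeasureTheory.integrable_prod_iff' hcont.aestronglyMeasurable]
    have hae : ∀ᵐ t ∂μ, (0:ℝ) < t := by
      rw [hμ]; exact ae_restrict_mem measurableSet_Ioi
    constructor
    · exact hae.mono fun t ht => hsec t ht
    · have heq : (fun t : ℝ => (1 + t ^ 2)⁻¹) =ᵐ[μ] fun t => ∫ u, ‖Function.uncurry f (u, t)‖ ∂μ := by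
        refine hae.mono fun t ht => ?_
        simp only [Function.uncurry]
        rw [← step3 t ht]
        refine integral_congr_ae (ae_of_all _ fun u => ?_)
        simp only
        rw [Real.norm_eq_abs, abs_of_nonneg (hf_nonneg u t ht.le)]
      refine Integrable.congr ?_ heq
      rw [hμ]
      exact integrable_inv_one_add_sq.integrableOn
  have step2 : ∫ u, ∫ t, f u t ∂μ ∂μ = ∫ t, ∫ u, f u t ∂μ ∂μ :=
    MeasureTheory.integral_integral_swap hint
  have step4 : ∫ t, ∫ u, f u t ∂μ ∂μ = ∫ t in Ioi (0:ℝ), (1 + t ^ 2)⁻¹ := by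
    rw [hμ]
    exact setIntegral_congr_fun measurableSet_Ioi fun t ht => step3 t ht
  rw [step1, step2, step4, integral_Ioi_inv_one_add_sq_eq_pi_div_two]

/-- **The Fejér-kernel representation of the absolute value**:
`|q| = (2/π) ∫₀^∞ (1 - cos (βq)) β⁻² dβ` for every real `q` (from
`integral_Ioi_one_sub_cos_div_sq` by the substitution `u = |q| β`).
[cite: Katznelson2004, Ch. VI §1.9 (1.8), p. 153–154] -/
theorem abs_eq_integral_one_sub_cos_div_sq (q : ℝ) :
    |q| = 2 / π * ∫ β in Ioi (0:ℝ), (1 - cos (β * q)) / β ^ 2 := by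
  rcases eq_or_ne q 0 with rfl | hq
  · simp
  have ha : 0 < |q| := abs_pos.mpr hq
  have hcos : ∀ β : ℝ, cos (β * q) = cos (|q| * β) := by
    intro β
    rcases le_or_gt 0 q with h | h
    · rw [abs_of_nonneg h, mul_comm]
    · rw [abs_of_neg h, neg_mul, cos_neg, mul_comm]
  simp_rw [hcos]
  have e : ∀ β : ℝ, (1 - cos (|q| * β)) / β ^ 2
      = |q| ^ 2 * ((fun v : ℝ => (1 - cos v) / v ^ 2) (|q| * β)) := by
    intro β
    simp only
    rcases eq_or_ne β 0 with rfl | hβ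
    · simp
    · field_simp
  simp_rw [e]
  have hsub := MeasureTheory.integral_comp_mul_left_Ioi (fun v : ℝ => (1 - cos v) / v ^ 2) 0 ha
  simp only [mul_zero] at hsub
  rw [integral_const_mul, hsub, integral_Ioi_one_sub_cos_div_sq, smul_eq_mul]
  field_simp

/-! ## Absolute values as integrated cosine defects -/

/-- The elementary bound `1 - cos y ≤ min 2 (y²/2)`. [folklore] -/
private theorem one_sub_cos_le_min (y : ℝ) : 1 - cos y ≤ min 2 (y ^ 2 / 2) := by
  refine le_min ?_ ?_
  · linarith [neg_one_le_cos y]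
  · linarith [Real.one_sub_sq_div_two_le_cos (x := y)]

/-- Integrability on `(0, ∞)` of the dominating kernel `β ↦ min (2/β²) C` (`0 ≤ C`). [folklore] -/
private theorem integrableOn_min_two_div_sq {C : ℝ} (hC : 0 ≤ C) :
    IntegrableOn (fun β : ℝ => min (2 / β ^ 2) C) (Ioi 0) := by
  have hmeas : Measurable fun β : ℝ => min (2 / β ^ 2) C :=
    (measurable_const.div (measurable_id.pow_const 2)).min measurable_const
  have h1 : IntegrableOn (fun β : ℝ => min (2 / β ^ 2) C) (Ioc 0 1) := by
    refine Measure.integrableOn_of_bounded (M := C) measure_Ioc_lt_top.ne hmeas.aestronglyMeasurable ?_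
    refine (ae_restrict_mem measurableSet_Ioc).mono fun β _ => ?_
    rw [Real.norm_eq_abs, abs_of_nonneg (le_min (by positivity) hC)]
    exact min_le_right _ _
  have h2 : IntegrableOn (fun β : ℝ => min (2 / β ^ 2) C) (Ioi 1) := by
    have hr : IntegrableOn (fun β : ℝ => β ^ (-2:ℝ)) (Ioi 1) :=
      integrableOn_Ioi_rpow_of_lt (by norm_num) zero_lt_one
    refine (hr.const_mul 2).mono' hmeas.aestronglyMeasurable ?_
    refine (ae_restrict_mem measurableSet_Ioi).mono fun β hβ => ?_
    have hβ0 : 0 < β := zero_lt_one.trans hβ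
    rw [Real.norm_eq_abs, abs_of_nonneg (le_min (by positivity) hC)]
    calc min (2 / β ^ 2) C ≤ 2 / β ^ 2 := min_le_left _ _
      _ = 2 * β ^ (-2:ℝ) := by
        rw [Real.rpow_neg hβ0.le, ← Real.rpow_natCast β 2]
        simp [div_eq_mul_inv]
  have h := h1.union h2
  rwa [Ioc_union_Ioi_eq_Ioi zero_le_one] at h

/-- **Absolute values as integrated cosine defects.** For a finite measure `μ`, an integrable
`F` and an a.e.-bounded (a.e. strongly) measurable `ξ`,
`∫ F·|ξ| dμ = (2/π) ∫₀^∞ (∫ F (1 - cos (β ξ)) dμ) β⁻² dβ`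
(the pointwise identity `abs_eq_integral_one_sub_cos_div_sq` and Fubini, the integrand being
dominated on `μ ⊗ dβ|_{(0,∞)}` by `|F| · min (2β⁻², B²/2)`). This is the identity behind the
characteristic-function evaluation of integrals `∫ F |ξ|`: the inner integrals are cosine transforms.
[cite: Katznelson2004, Ch. VI §1.9 (1.8), p. 153–154] -/
theorem integral_mul_abs_eq_integral_cosDefect {α : Type*} [MeasurableSpace α] (μ : Measure α)
    [IsFiniteMeasure μ] {F ξ : α → ℝ} (hF : Integrable F μ) (hξ : AEStronglyMeasurable ξ μ)
    {B : ℝ} (hB : ∀ᵐ x ∂μ, |ξ x| ≤ B) :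
    ∫ x, F x * |ξ x| ∂μ
      = 2 / π * ∫ β in Ioi (0:ℝ), (∫ x, F x * (1 - cos (β * ξ x)) ∂μ) / β ^ 2 := by
  set ν : Measure ℝ := volume.restrict (Ioi (0:ℝ)) with hν
  set G : α → ℝ → ℝ := fun x β => F x * ((1 - cos (β * ξ x)) / β ^ 2) with hG
  have hB0 : 0 ≤ B ∨ μ = 0 := by
    by_cases hμ : μ = 0
    · exact Or.inr hμ
    · left
      have hex : ∃ x, |ξ x| ≤ B := by
        by_contra h
        push Not at h
        have hall : ∀ᵐ x ∂μ, False := hB.mono fun x hx => lt_irrefl _ (hx.trans_lt (h x))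
        rw [ae_iff] at hall
        simp only [not_false_eq_true, setOf_true] at hall
        exact hμ (Measure.measure_univ_eq_zero.mp hall)
      obtain ⟨x, hx⟩ := hex
      exact (abs_nonneg _).trans hx
  rcases hB0 with hB0 | hμ0
  swap
  · subst hμ0; simp
  have hpt : ∀ x, F x * |ξ x| = 2 / π * ∫ β, G x β ∂ν := by
    intro x
    rw [abs_eq_integral_one_sub_cos_div_sq (ξ x), hν]
    simp only [hG]
    rw [integral_const_mul]
    ring
  have hGm : AEStronglyMeasurable (Function.uncurry G) (μ.prod ν) := by
    simp only [hG]
    have h1 : AEStronglyMeasurable (fun p : α × ℝ => F p.1) (μ.prod ν) :=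
      hF.aestronglyMeasurable.comp_fst
    have h2 : AEStronglyMeasurable (fun p : α × ℝ => ξ p.1) (μ.prod ν) := hξ.comp_fst
    have h3 : AEStronglyMeasurable (fun p : α × ℝ => p.2) (μ.prod ν) :=
      measurable_snd.aestronglyMeasurable
    have h4 : AEStronglyMeasurable (fun p : α × ℝ => (1 - cos (p.2 * ξ p.1)) / p.2 ^ 2) (μ.prod ν) :=
      ((aemeasurable_const.sub ((h3.aemeasurable.mul h2.aemeasurable).cos)).div
        (h3.aemeasurable.pow_const 2)).aestronglyMeasurable
    exact h1.mul h4
  have hdom : Integrable (fun p : α × ℝ => |F p.1| * min (2 / p.2 ^ 2) (B ^ 2 / 2)) (μ.prod ν) := by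
    have hi := hF.abs.mul_prod
      ((integrableOn_min_two_div_sq (C := B ^ 2 / 2) (by positivity)).integrable)
    rw [hν]
    simpa using hi
  have hint : Integrable (Function.uncurry G) (μ.prod ν) := by
    have hx : ∀ᵐ p ∂(μ.prod ν), |ξ p.1| ≤ B :=
      (Measure.quasiMeasurePreserving_fst (μ := μ) (ν := ν)).ae hB
    have hb : ∀ᵐ p ∂(μ.prod ν), (0:ℝ) < p.2 := by
      have : ∀ᵐ β ∂ν, (0:ℝ) < β := by rw [hν]; exact ae_restrict_mem measurableSet_Ioi
      exact (Measure.quasiMeasurePreserving_snd (μ := μ) (ν := ν)).ae this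
    refine hdom.mono hGm ((hx.and hb).mono fun p hp => ?_)
    obtain ⟨hxB, hb⟩ := hp
    simp only [hG, Function.uncurry]
    have hb2 : 0 < p.2 ^ 2 := by positivity
    have hnn : 0 ≤ (1 - cos (p.2 * ξ p.1)) / p.2 ^ 2 :=
      div_nonneg (by linarith [cos_le_one (p.2 * ξ p.1)]) hb2.le
    have hle : (1 - cos (p.2 * ξ p.1)) / p.2 ^ 2 ≤ min (2 / p.2 ^ 2) (B ^ 2 / 2) := by
      refine le_min ?_ ?_
      · exact div_le_div_of_nonneg_right (by linarith [neg_one_le_cos (p.2 * ξ p.1)]) hb2.le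
      · rw [div_le_iff₀ hb2]
        have h1 := Real.one_sub_sq_div_two_le_cos (x := p.2 * ξ p.1)
        have h2 : (ξ p.1) ^ 2 ≤ B ^ 2 := by
          rw [← sq_abs (ξ p.1)]
          exact pow_le_pow_left₀ (abs_nonneg _) hxB 2
        nlinarith
    rw [norm_mul, norm_mul, Real.norm_eq_abs, Real.norm_eq_abs, Real.norm_eq_abs, Real.norm_eq_abs,
      abs_abs, abs_of_nonneg hnn,
      abs_of_nonneg (le_min (by positivity : (0:ℝ) ≤ 2 / p.2 ^ 2) (by positivity : (0:ℝ) ≤ B ^ 2 / 2))]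
    exact mul_le_mul_of_nonneg_left hle (abs_nonneg _)
  calc ∫ x, F x * |ξ x| ∂μ = ∫ x, 2 / π * ∫ β, G x β ∂ν ∂μ := by
        refine integral_congr_ae (ae_of_all _ fun x => ?_); exact hpt x
    _ = 2 / π * ∫ x, ∫ β, G x β ∂ν ∂μ := integral_const_mul _ _
    _ = 2 / π * ∫ β, ∫ x, G x β ∂μ ∂ν := by rw [integral_integral_swap hint]
    _ = 2 / π * ∫ β in Ioi (0:ℝ), (∫ x, F x * (1 - cos (β * ξ x)) ∂μ) / β ^ 2 := by
        rw [hν]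
        congr 1
        refine integral_congr_ae (ae_of_all _ fun β => ?_)
        simp only [hG]
        rw [← integral_div]
        congr 1
        funext x
        ring

/-- **Scaled form.** For `c > 0`:
`∫ F·|ξ| dμ = (2/(πc)) ∫₀^∞ (∫ F (1 - cos (β c ξ)) dμ) β⁻² dβ` (the previous identity for `c ξ`).
With `c = d` and `ξ = D̂^{(x)}` the phase `β d D̂^{(x)}(k)` is a plain sum over the `2^d d!` signed
permutations, which is the form in which the inner integrals factorise over coordinates.
[cite: Katznelson2004, Ch. VI §1.9 (1.8), p. 153–154] -/
theorem integral_mul_abs_eq_integral_cosDefect_scaled {α : Type*} [MeasurableSpace α]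
    (μ : Measure α) [IsFiniteMeasure μ] {F ξ : α → ℝ} (hF : Integrable F μ)
    (hξ : AEStronglyMeasurable ξ μ) {B : ℝ} (hB : ∀ᵐ x ∂μ, |ξ x| ≤ B) {c : ℝ} (hc : 0 < c) :
    ∫ x, F x * |ξ x| ∂μ
      = 2 / (π * c) * ∫ β in Ioi (0:ℝ), (∫ x, F x * (1 - cos (β * c * ξ x)) ∂μ) / β ^ 2 := by
  have hξ' : AEStronglyMeasurable (fun x => c * ξ x) μ := hξ.const_mul c
  have hB' : ∀ᵐ x ∂μ, |c * ξ x| ≤ c * B :=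
    hB.mono fun x hx => by rw [abs_mul, abs_of_pos hc]; exact mul_le_mul_of_nonneg_left hx hc.le
  have h := integral_mul_abs_eq_integral_cosDefect μ hF hξ' hB'
  have hl : ∫ x, F x * |c * ξ x| ∂μ = c * ∫ x, F x * |ξ x| ∂μ := by
    rw [← integral_const_mul]
    refine integral_congr_ae (ae_of_all _ fun x => ?_)
    simp only
    rw [abs_mul, abs_of_pos hc]
    ring
  rw [hl] at h
  have h' : ∫ x, F x * |ξ x| ∂μ
      = c⁻¹ * (2 / π * ∫ β in Ioi (0:ℝ), (∫ x, F x * (1 - cos (β * (c * ξ x))) ∂μ) / β ^ 2) := by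
    rw [← h, ← mul_assoc, inv_mul_cancel₀ hc.ne', one_mul]
  rw [h']
  simp_rw [← mul_assoc]
  field_simp

/-! ## The instance `K_{n,l}(x)` -/

variable {d : ℕ}

/-- **`K_{n,l}(x)` as an integrated cosine defect** (`d ≥ 2n + 1`):
`K_{n,l}(x) = (2/π) ∫₀^∞ β⁻² ( ∫ |D̂|^l (1 - cos (β D̂^{(x)})) Ĉⁿ dk/(2π)^d ) dβ`, the instance
`F = |D̂|^l Ĉⁿ`, `ξ = D̂^{(x)}` (`|D̂^{(x)}| ≤ 1`) of `integral_mul_abs_eq_integral_cosDefect` on the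
cube `([-π,π]^d, P d)`. The inner integrals are cosine transforms of the law of `D̂^{(x)}` under the
(signed, finite) weight `|D̂|^l Ĉⁿ dk`; for `x = m e₁` and even `l` they factorise over coordinates.
[cite: FitznerVanDerHofstad2016NoBLE, (3.34)–(3.36) p. 1071] -/
theorem srwK_eq_integral_cosDefect {n : ℕ} (hd : 2 * n + 1 ≤ d) (l : ℕ) (x : Fin d → ℤ) :
    srwK d n l x = 2 / π * ∫ β in Ioi (0:ℝ),
      ((∫ k, (|Dhat d k| ^ l * (1 - cos (β * DhatSym d x k))) * Chat d 1 k ^ n ∂P d) / (2 * π) ^ d)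
        / β ^ 2 := by
  have hF : Integrable (fun k => |Dhat d k| ^ l * Chat d 1 k ^ n) (P d) :=
    integrable_weight_mul_Chat_pow hd ((continuous_Dhat d).measurable.abs.pow_const l) fun k => by
      rw [abs_of_nonneg (pow_nonneg (abs_nonneg _) l)]; exact abs_Dhat_pow_le_one l k
  have hξ : AEStronglyMeasurable (DhatSym d x) (P d) := (continuous_DhatSym d x).aestronglyMeasurable
  have h := integral_mul_abs_eq_integral_cosDefect (P d) hF hξ (B := 1)
    (ae_of_all _ fun k => abs_DhatSym_le_one x k)
  unfold srwK
  have e1 : (fun k => (|Dhat d k| ^ l * |DhatSym d x k|) * Chat d 1 k ^ n)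
      = fun k => (|Dhat d k| ^ l * Chat d 1 k ^ n) * |DhatSym d x k| := by
    funext k; ring
  rw [e1, h, mul_div_assoc]
  congr 1
  rw [← integral_div]
  refine integral_congr_ae (ae_of_all _ fun β => ?_)
  simp only
  have hAB : ∫ k, |Dhat d k| ^ l * Chat d 1 k ^ n * (1 - cos (β * DhatSym d x k)) ∂P d
      = ∫ k, |Dhat d k| ^ l * (1 - cos (β * DhatSym d x k)) * Chat d 1 k ^ n ∂P d :=
    integral_congr_ae (ae_of_all _ fun k => by simp only; ring)
  rw [hAB]
  ring

/-- **Scaled instance** (`d ≥ 2n + 1`, so `d > 0`):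
`K_{n,l}(x) = (2/(πd)) ∫₀^∞ β⁻² ( ∫ |D̂|^l (1 - cos (β d D̂^{(x)})) Ĉⁿ dk/(2π)^d ) dβ` — the
characteristic-function form of `K_{n,l}(x)` with the phase `β d D̂^{(x)}(k)`
(`= β Σ_j cos (m k_j)` for `x = m e₁`).
[cite: FitznerVanDerHofstad2016NoBLE, (3.34)–(3.36) p. 1071] -/
theorem srwK_eq_integral_cosDefect_scaled {n : ℕ} (hd : 2 * n + 1 ≤ d) (l : ℕ) (x : Fin d → ℤ) :
    srwK d n l x = 2 / (π * d) * ∫ β in Ioi (0:ℝ),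
      ((∫ k, (|Dhat d k| ^ l * (1 - cos (β * d * DhatSym d x k))) * Chat d 1 k ^ n ∂P d)
          / (2 * π) ^ d) / β ^ 2 := by
  have hd0 : (0:ℝ) < d := by exact_mod_cast (show 0 < d by omega)
  have hF : Integrable (fun k => |Dhat d k| ^ l * Chat d 1 k ^ n) (P d) :=
    integrable_weight_mul_Chat_pow hd ((continuous_Dhat d).measurable.abs.pow_const l) fun k => by
      rw [abs_of_nonneg (pow_nonneg (abs_nonneg _) l)]; exact abs_Dhat_pow_le_one l k
  have hξ : AEStronglyMeasurable (DhatSym d x) (P d) := (continuous_DhatSym d x).aestronglyMeasurable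
  have h := integral_mul_abs_eq_integral_cosDefect_scaled (P d) hF hξ (B := 1)
    (ae_of_all _ fun k => abs_DhatSym_le_one x k) hd0
  unfold srwK
  have e1 : (fun k => (|Dhat d k| ^ l * |DhatSym d x k|) * Chat d 1 k ^ n)
      = fun k => (|Dhat d k| ^ l * Chat d 1 k ^ n) * |DhatSym d x k| := by
    funext k; ring
  rw [e1, h, mul_div_assoc]
  congr 1
  rw [← integral_div]
  refine integral_congr_ae (ae_of_all _ fun β => ?_)
  simp only
  have hAB : ∫ k, |Dhat d k| ^ l * Chat d 1 k ^ n * (1 - cos (β * d * DhatSym d x k)) ∂P d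
      = ∫ k, |Dhat d k| ^ l * (1 - cos (β * d * DhatSym d x k)) * Chat d 1 k ^ n ∂P d :=
    integral_congr_ae (ae_of_all _ fun k => by simp only; ring)
  rw [hAB]
  ring

/-! ## Part II — characteristic function of `D̂` and the Bessel representation of `κ_d` -/

open Literature.Barriers.CriticalPhenomena.Slade2006Prop53 (μI integral_one_μI)
open Literature.Analysis.FunctionSpaces (besselJ integral_cos_mul_cos_eq_pi_mul_besselJ_zero)

section CharFun

variable {d : ℕ}

/-! ### The characteristic function of `cos k` on `[-π, π]` is `2π J₀` -/

/-- `∫_{-π}^{π} cos(y cos k) dk = 2π J₀(y)`: Poisson's / Bessel's integral `J₀(y) = π⁻¹∫₀^π cos(y cos θ) dθ`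
(the tree's `integral_cos_mul_cos_eq_pi_mul_besselJ_zero`) doubled by evenness of `cos`.
[cite: DLMF, 10.9.1–10.9.2] -/
theorem integral_cos_mul_cos_μI (y : ℝ) :
    ∫ k, Real.cos (y * Real.cos k) ∂μI = 2 * π * besselJ 0 y := by
  have hc : Continuous fun k : ℝ => Real.cos (y * Real.cos k) := by fun_prop
  rw [show μI = volume.restrict (Icc (-π) π) from rfl, integral_Icc_eq_integral_Ioc,
    ← intervalIntegral.integral_of_le (by linarith [pi_pos] : -π ≤ π),
    ← intervalIntegral.integral_add_adjacent_intervals (b := 0) (hc.intervalIntegrable _ _)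
      (hc.intervalIntegrable _ _)]
  have h1 : ∫ k in (-π)..0, Real.cos (y * Real.cos k) = ∫ k in (0:ℝ)..π, Real.cos (y * Real.cos k) := by
    have h := intervalIntegral.integral_comp_neg (a := 0) (b := π)
      (fun k => Real.cos (y * Real.cos k))
    simp only [Real.cos_neg, neg_zero] at h
    exact h.symm
  rw [h1, integral_cos_mul_cos_eq_pi_mul_besselJ_zero]
  ring

/-- `∫_{-π}^{π} sin(y cos k) dk = 0` (the substitution `k ↦ k - π` on `[0, π]` flips the sign of
`cos`), i.e. the imaginary part of Bessel's integral `∫_{-π}^{π} e^{iy cos k} dk` vanishes.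
[cite: DLMF, 10.9.2] -/
theorem integral_sin_mul_cos_μI (y : ℝ) :
    ∫ k, Real.sin (y * Real.cos k) ∂μI = 0 := by
  have hc : Continuous fun k : ℝ => Real.sin (y * Real.cos k) := by fun_prop
  rw [show μI = volume.restrict (Icc (-π) π) from rfl, integral_Icc_eq_integral_Ioc,
    ← intervalIntegral.integral_of_le (by linarith [pi_pos] : -π ≤ π),
    ← intervalIntegral.integral_add_adjacent_intervals (b := 0) (hc.intervalIntegrable _ _)
      (hc.intervalIntegrable _ _)]
  have h1 : ∫ k in (-π)..0, Real.sin (y * Real.cos k) =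
      -∫ k in (0:ℝ)..π, Real.sin (y * Real.cos k) := by
    have h := intervalIntegral.integral_comp_sub_right (a := 0) (b := π)
      (fun k => Real.sin (y * Real.cos k)) π
    simp only [Real.cos_sub_pi, mul_neg, Real.sin_neg, zero_sub, sub_self,
      intervalIntegral.integral_neg] at h
    exact h.symm
  rw [h1]
  ring

/-- Bounded continuous functions are integrable against a finite measure. [folklore] -/
private lemma integrable_of_continuous_of_bound {α : Type*} [MeasurableSpace α]
    [TopologicalSpace α] [OpensMeasurableSpace α] (μ : Measure α) [IsFiniteMeasure μ]
    {E : Type*} [NormedAddCommGroup E] [SecondCountableTopologyEither α E] {f : α → E}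
    (hf : Continuous f) (C : ℝ)
    (hC : ∀ x, ‖f x‖ ≤ C) : Integrable f μ :=
  (integrable_const C).mono' hf.aestronglyMeasurable (ae_of_all _ hC)

/-- **Bessel's integral**, complex form: `∫_{-π}^{π} e^{i y cos k} dk = 2π J₀(y)` — `J₀` is the
characteristic function of `cos Θ`, `Θ` uniform on `[-π, π]`, up to the mass `2π`.
[cite: DLMF, 10.9.2] -/
theorem integral_cexp_mul_cos_μI (y : ℝ) :
    ∫ k, Complex.exp (((y * Real.cos k : ℝ) : ℂ) * Complex.I) ∂μI
      = ((2 * π * besselJ 0 y : ℝ) : ℂ) := by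
  have h : ∀ k : ℝ, Complex.exp (((y * Real.cos k : ℝ) : ℂ) * Complex.I)
      = ((Real.cos (y * Real.cos k) : ℝ) : ℂ) + ((Real.sin (y * Real.cos k) : ℝ) : ℂ) * Complex.I := by
    intro k
    rw [Complex.exp_mul_I, ← Complex.ofReal_cos, ← Complex.ofReal_sin]
  simp_rw [h]
  have hi1 : Integrable (fun k : ℝ => ((Real.cos (y * Real.cos k) : ℝ) : ℂ)) μI :=
    integrable_of_continuous_of_bound μI (by fun_prop) 1
      (fun k => by rw [Complex.norm_real]; exact abs_cos_le_one _)
  have hi2 : Integrable (fun k : ℝ => ((Real.sin (y * Real.cos k) : ℝ) : ℂ) * Complex.I) μI :=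
    (integrable_of_continuous_of_bound μI (by fun_prop) 1
      (fun k => by rw [Complex.norm_real]; exact abs_sin_le_one _)).mul_const _
  rw [integral_add hi1 hi2, integral_mul_const, integral_complex_ofReal, integral_complex_ofReal,
    integral_cos_mul_cos_μI, integral_sin_mul_cos_μI]
  simp

/-! ### On the cube: `∫_{[-π,π]^d} e^{iβ Σ_j cos k_j} dk = (2π J₀(β))^d` -/

/-- `∫_{[-π,π]^d} e^{iβ Σ_j cos k_j} dk = (2π J₀(β))^d`: the exponential of the sum is the product
of the one-coordinate exponentials and the cube measure `P d = μI^{⊗d}` is a product measure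
(`MeasureTheory.integral_fintype_prod_eq_prod`), each factor being Bessel's integral
`integral_cexp_mul_cos_μI`. This is the characteristic function of `d·D̂(k) = Σ_j cos k_j`
under Lebesgue measure on the cube. [cite: DLMF, 10.9.2] -/
theorem integral_cexp_mul_sum_cos_P (β : ℝ) :
    ∫ k, Complex.exp (((β * ∑ j, Real.cos (k j) : ℝ) : ℂ) * Complex.I) ∂P d
      = ((2 * π * besselJ 0 β : ℝ) : ℂ) ^ d := by
  have h : ∀ k : Fin d → ℝ, Complex.exp (((β * ∑ j, Real.cos (k j) : ℝ) : ℂ) * Complex.I)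
      = ∏ j, Complex.exp (((β * Real.cos (k j) : ℝ) : ℂ) * Complex.I) := by
    intro k
    rw [← Complex.exp_sum, Finset.mul_sum]
    push_cast
    rw [Finset.sum_mul]
  simp_rw [h]
  rw [show P d = Measure.pi (fun _ : Fin d => μI) from rfl,
    integral_fintype_prod_eq_prod (𝕜 := ℂ)
      (fun (_ : Fin d) (t : ℝ) => Complex.exp (((β * Real.cos t : ℝ) : ℂ) * Complex.I))]
  simp_rw [integral_cexp_mul_cos_μI]
  rw [Finset.prod_const, Finset.card_univ, Fintype.card_fin]

/-- Real part: `∫_{[-π,π]^d} cos(β Σ_j cos k_j) dk = (2π J₀(β))^d`. [cite: DLMF, 10.9.2] -/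
theorem integral_cos_mul_sum_cos_P (β : ℝ) :
    ∫ k, Real.cos (β * ∑ j, Real.cos (k j)) ∂P d = (2 * π * besselJ 0 β) ^ d := by
  have hint : Integrable
      (fun k : Fin d → ℝ => Complex.exp (((β * ∑ j, Real.cos (k j) : ℝ) : ℂ) * Complex.I)) (P d) :=
    integrable_of_continuous_of_bound (P d) (by fun_prop) 1
      (fun k => by rw [Complex.norm_exp_ofReal_mul_I])
  have h2 : (fun k : Fin d → ℝ => Real.cos (β * ∑ j, Real.cos (k j)))
      = fun k => RCLike.re (Complex.exp (((β * ∑ j, Real.cos (k j) : ℝ) : ℂ) * Complex.I)) := by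
    funext k
    rw [RCLike.re_to_complex, Complex.exp_ofReal_mul_I_re]
  rw [h2, integral_re hint, integral_cexp_mul_sum_cos_P, RCLike.re_to_complex,
    ← Complex.ofReal_pow, Complex.ofReal_re]

/-- `β d D̂(k) = β Σ_j cos k_j` (also for `d = 0`, where both sides vanish). [folklore] -/
private theorem mul_natCast_mul_Dhat (β : ℝ) (k : Fin d → ℝ) :
    β * d * Dhat d k = β * ∑ j, Real.cos (k j) := by
  rcases Nat.eq_zero_or_pos d with hd | hd
  · subst hd; simp [Dhat]
  · have hd' : (d : ℝ) ≠ 0 := by exact_mod_cast hd.ne'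
    rw [Dhat_def]
    field_simp

/-- `∫_{[-π,π]^d} cos(β d D̂(k)) dk = (2π J₀(β))^d` — the phase `β d ξ` of the scaled
cosine-defect representation (`integral_mul_abs_eq_integral_cosDefect_scaled` with `c = d`)
evaluated in closed form for `ξ = D̂`. [cite: DLMF, 10.9.2] -/
theorem integral_cos_mul_Dhat_P (β : ℝ) :
    ∫ k, Real.cos (β * d * Dhat d k) ∂P d = (2 * π * besselJ 0 β) ^ d := by
  simp_rw [mul_natCast_mul_Dhat]
  exact integral_cos_mul_sum_cos_P β

/-- `∫_{[-π,π]^d} 1 dk = (2π)^d` (the normalising volume of the cube in the SRW integrals (3.34)–(3.36)).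
[cite: FitznerVanDerHofstad2016NoBLE, (3.34)–(3.36) p. 1071] -/
theorem integral_one_P : ∫ _k, (1 : ℝ) ∂P d = (2 * π) ^ d := by
  have h := integral_fintype_prod_eq_prod (𝕜 := ℝ) (fun (_ : Fin d) (_ : ℝ) => (1 : ℝ))
    (μ := fun _ : Fin d => μI)
  simp only [Finset.prod_const_one] at h
  rw [show P d = Measure.pi (fun _ : Fin d => μI) from rfl, h]
  simp_rw [integral_one_μI]
  rw [Finset.prod_const, Finset.card_univ, Fintype.card_fin]

/-- `∫_{[-π,π]^d} (1 - cos(β d D̂(k))) dk = (2π)^d (1 - J₀(β)^d)`: the inner integral of the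
cosine-defect representation of `κ_d = ∫ |D̂|`. [cite: DLMF, 10.9.2] -/
theorem integral_one_sub_cos_mul_Dhat_P (β : ℝ) :
    ∫ k, (1 - Real.cos (β * d * Dhat d k)) ∂P d = (2 * π) ^ d * (1 - besselJ 0 β ^ d) := by
  have hint : Integrable (fun k : Fin d → ℝ => Real.cos (β * d * Dhat d k)) (P d) :=
    integrable_of_continuous_of_bound (P d)
      (Real.continuous_cos.comp (continuous_const.mul (continuous_Dhat d))) 1
      (fun k => by rw [Real.norm_eq_abs]; exact abs_cos_le_one _)
  rw [integral_sub (integrable_const _) hint, integral_one_P, integral_cos_mul_Dhat_P, mul_pow]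
  ring

/-! ### `κ_d` as a one-dimensional Bessel integral -/

/-- **`κ_d = ∫_{[-π,π]^d} |D̂(k)| dk/(2π)^d = (2/(πd)) ∫₀^∞ (1 - J₀(β)^d) β⁻² dβ`** (`d ≥ 1`):
the scaled cosine-defect (Fejér-kernel) representation of `|D̂|`
(`integral_mul_abs_eq_integral_cosDefect_scaled`, `F = 1`, `ξ = D̂`, `c = d`) with the inner
cube integral evaluated by Bessel's integral (`integral_one_sub_cos_mul_Dhat_P`). The
`d`-dimensional integral with the non-smooth weight `|D̂|` becomes a one-dimensional integral of
an entire integrand. [cite: DLMF, 10.9.2; Katznelson2004, Ch. VI §1.9 (1.8), p. 153–154] -/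
theorem integral_abs_Dhat_div_eq_integral_besselJ (hd : 0 < d) :
    (∫ k, |Dhat d k| ∂P d) / (2 * π) ^ d
      = 2 / (π * d) * ∫ β in Ioi (0:ℝ), (1 - besselJ 0 β ^ d) / β ^ 2 := by
  have hF : Integrable (fun _ : Fin d → ℝ => (1 : ℝ)) (P d) := integrable_const _
  have hξ : AEStronglyMeasurable (Dhat d) (P d) := (continuous_Dhat d).aestronglyMeasurable
  have hB : ∀ᵐ k ∂P d, |Dhat d k| ≤ 1 := ae_of_all _ (fun k => abs_Dhat_le_one k)
  have hc : (0 : ℝ) < d := by exact_mod_cast hd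
  have h := integral_mul_abs_eq_integral_cosDefect_scaled (P d) hF hξ hB hc
  simp only [one_mul] at h
  simp_rw [integral_one_sub_cos_mul_Dhat_P] at h
  rw [h]
  have e : ∀ β : ℝ, (2 * π) ^ d * (1 - besselJ 0 β ^ d) / β ^ 2
      = (2 * π) ^ d * ((1 - besselJ 0 β ^ d) / β ^ 2) := fun β => by ring
  simp_rw [e, integral_const_mul]
  have hπ : (0 : ℝ) < (2 * π) ^ d := by positivity
  field_simp

/-- **`K_{0,0}(e_i) = κ_d = (2/(πd)) ∫₀^∞ (1 - J₀(β)^d) β⁻² dβ`**: the simplest of the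
`x`-dependent SRW integrals `K_{n,l}(x) = ∫ |D̂|^l Ĉⁿ |D̂^{(x)}| dk/(2π)^d` ((3.36)) in closed
Bessel form (`D̂^{(e_i)} = D̂`, `DhatSym_single`).
[cite: FitznerVanDerHofstad2016NoBLE, (3.34)–(3.36) p. 1071; DLMF, 10.9.2] -/
theorem srwK_zero_zero_single_eq_integral_besselJ (i : Fin d) :
    srwK d 0 0 (Pi.single i 1)
      = 2 / (π * d) * ∫ β in Ioi (0:ℝ), (1 - besselJ 0 β ^ d) / β ^ 2 := by
  have hd : 0 < d := Nat.pos_of_ne_zero (by intro h; subst h; exact Fin.elim0 i)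
  rw [← integral_abs_Dhat_div_eq_integral_besselJ hd]
  unfold srwK
  congr 1
  refine integral_congr_ae (ae_of_all _ fun k => ?_)
  simp only [DhatSym_single, pow_zero, one_mul, mul_one]

end CharFun

/-! ## Part III — the Bessel-side tail and the `κ_d` bracket -/

section KappaTail

open Literature.Analysis.FunctionSpaces

/-- `J₀(β) ≥ 1 - β²/4` for every real `β`: Poisson's integral `J₀(β) = π⁻¹∫₀^π cos(β cos θ)dθ` (the tree's
`besselJ_zero_eq_integral_cos_mul_cos`) and `cos y ≥ 1 - y²/2`, `∫₀^π cos²θ dθ = π/2`.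
[cite: AndrewsAskeyRoy1999, §4.9 (4.9.12)] -/
theorem one_sub_sq_div_four_le_besselJ_zero (β : ℝ) : 1 - β ^ 2 / 4 ≤ besselJ 0 β := by
  rw [besselJ_zero_eq_integral_cos_mul_cos]
  have hc : Continuous fun θ : ℝ => Real.cos (β * Real.cos θ) := by fun_prop
  have hp : Continuous fun θ : ℝ => 1 - (β * Real.cos θ) ^ 2 / 2 := by fun_prop
  have hle : ∫ θ in (0:ℝ)..π, (1 - (β * Real.cos θ) ^ 2 / 2) ≤ ∫ θ in (0:ℝ)..π, Real.cos (β * Real.cos θ) :=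
    intervalIntegral.integral_mono_on pi_pos.le (hp.intervalIntegrable _ _) (hc.intervalIntegrable _ _)
      (fun θ _ => Real.one_sub_sq_div_two_le_cos)
  have hval : ∫ θ in (0:ℝ)..π, (1 - (β * Real.cos θ) ^ 2 / 2) = π * (1 - β ^ 2 / 4) := by
    have e : (fun θ : ℝ => 1 - (β * Real.cos θ) ^ 2 / 2) = fun θ => 1 - (β ^ 2 / 2) * Real.cos θ ^ 2 := by
      funext θ; ring
    have i1 : IntervalIntegrable (fun _ : ℝ => (1:ℝ)) volume 0 π := intervalIntegrable_const
    have i2 : IntervalIntegrable (fun θ : ℝ => β ^ 2 / 2 * Real.cos θ ^ 2) volume 0 π :=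
      (by fun_prop : Continuous fun θ : ℝ => β ^ 2 / 2 * Real.cos θ ^ 2).intervalIntegrable _ _
    rw [e, intervalIntegral.integral_sub i1 i2, intervalIntegral.integral_const,
      intervalIntegral.integral_const_mul, integral_cos_sq]
    simp
    ring
  have hπ : 0 < π := pi_pos
  rw [hval] at hle
  calc 1 - β ^ 2 / 4 = π⁻¹ * (π * (1 - β ^ 2 / 4)) := by field_simp
    _ ≤ π⁻¹ * ∫ θ in (0:ℝ)..π, Real.cos (β * Real.cos θ) :=
        mul_le_mul_of_nonneg_left hle (by positivity)

variable (d : ℕ)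

/-- `J₀(β)^d ≤ 1`. [cite: DLMF, 10.14.1] -/
theorem besselJ_zero_pow_le_one (β : ℝ) : besselJ 0 β ^ d ≤ 1 :=
  (le_abs_self _).trans (by rw [abs_pow]; exact pow_le_one₀ (abs_nonneg _) (abs_besselJ_zero_le_one_holds β))

/-- `-1 ≤ J₀(β)^d`. [cite: DLMF, 10.14.1] -/
theorem neg_one_le_besselJ_zero_pow (β : ℝ) : -1 ≤ besselJ 0 β ^ d :=
  (abs_le.1 (by rw [abs_pow]; exact pow_le_one₀ (abs_nonneg _) (abs_besselJ_zero_le_one_holds β))).1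

/-- `1 - J₀(β)^d ≤ dβ²/4`: Bernoulli's inequality `(1 + x)^d ≥ 1 + dx` (`x = J₀ - 1 ≥ -2`) and `J₀ ≥ 1 - β²/4`.
[cite: DLMF, 10.14.1] -/
theorem one_sub_besselJ_zero_pow_le (β : ℝ) : 1 - besselJ 0 β ^ d ≤ d * (β ^ 2 / 4) := by
  -- Bernoulli: (1 + x)^d ≥ 1 + d x for x ≥ -2, with x = J₀ - 1 ≥ -2
  have hx : (-2 : ℝ) ≤ besselJ 0 β - 1 := by
    linarith [(abs_le.1 (abs_besselJ_zero_le_one_holds β)).1]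
  have hB := one_add_mul_le_pow hx d
  have h1 : (1 : ℝ) + (besselJ 0 β - 1) = besselJ 0 β := by ring
  rw [h1] at hB
  have h2 := one_sub_sq_div_four_le_besselJ_zero β
  have hd : (0 : ℝ) ≤ d := Nat.cast_nonneg d
  nlinarith

/-- `0 ≤ (1 - J₀^d)/β²`. [cite: DLMF, 10.14.1] -/
theorem besselKappaIntegrand_nonneg (β : ℝ) : 0 ≤ ((1 - besselJ 0 β ^ d) / β ^ 2) :=
  div_nonneg (sub_nonneg.2 (besselJ_zero_pow_le_one d β)) (sq_nonneg β)

/-- `(1 - J₀^d)/β² ≤ d/4` (the integrand is bounded at `β = 0`). [cite: DLMF, 10.14.1] -/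
theorem besselKappaIntegrand_le_div_four (β : ℝ) : ((1 - besselJ 0 β ^ d) / β ^ 2) ≤ d / 4 := by
  rcases eq_or_ne β 0 with hβ | hβ
  · subst hβ; simp; positivity
  · rw [div_le_iff₀ (by positivity)]
    linarith [one_sub_besselJ_zero_pow_le d β]

/-- `(1 - J₀^d)/β² ≤ 2/β²`. [cite: DLMF, 10.14.1] -/
theorem besselKappaIntegrand_le_two_div_sq (β : ℝ) : ((1 - besselJ 0 β ^ d) / β ^ 2) ≤ 2 / β ^ 2 := by
  rcases eq_or_ne β 0 with hβ | hβ
  · subst hβ; simp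
  · exact div_le_div_of_nonneg_right (by linarith [neg_one_le_besselJ_zero_pow d β]) (sq_nonneg β)

/-- continuity on `(0, ∞)`. [cite: Watson1944, §2.11] -/
theorem continuous_besselKappaIntegrand_on : ContinuousOn (fun β : ℝ => (1 - besselJ 0 β ^ d) / β ^ 2) (Ioi 0) := by
  have hJ : Continuous (besselJ 0) := continuous_besselJ_holds 0
  exact ContinuousOn.div (by fun_prop) (by fun_prop) (fun β hβ => pow_ne_zero 2 (ne_of_gt hβ))

/-- `(1 - J₀^d)/β² ≤ min(d/4, 2/β²)`. [cite: DLMF, 10.14.1] -/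
theorem besselKappaIntegrand_le_min (β : ℝ) : ((1 - besselJ 0 β ^ d) / β ^ 2) ≤ min ((d : ℝ) / 4) (2 / β ^ 2) :=
  le_min (besselKappaIntegrand_le_div_four d β) (besselKappaIntegrand_le_two_div_sq d β)

/-- measurability. [cite: Watson1944, §2.11] -/
theorem measurable_besselKappaIntegrand : Measurable (fun β : ℝ => (1 - besselJ 0 β ^ d) / β ^ 2) := by
  have hJ : Continuous (besselJ 0) := continuous_besselJ_holds 0
  fun_prop

/-- `(1 - J₀^d)/β²` is integrable on `(0, ∞)` (dominated by `min(d/4, 2/β²)`).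
[cite: FitznerVanDerHofstad2016NoBLE, §5.1.1 (5.2)–(5.4); DLMF, 10.14.1] -/
theorem integrableOn_besselKappaIntegrand : IntegrableOn (fun β : ℝ => (1 - besselJ 0 β ^ d) / β ^ 2) (Ioi 0) := by
  have hm : AEStronglyMeasurable (fun β : ℝ => (1 - besselJ 0 β ^ d) / β ^ 2) (volume.restrict (Ioi 0)) :=
    (measurable_besselKappaIntegrand d).aestronglyMeasurable
  rw [← Ioc_union_Ioi_eq_Ioi zero_le_one]
  refine IntegrableOn.union ?_ ?_
  · -- bounded by d/4 on a set of finite measure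
    refine Measure.integrableOn_of_bounded (M := (d : ℝ) / 4) (measure_Ioc_lt_top).ne
      (measurable_besselKappaIntegrand d).aestronglyMeasurable ?_
    exact Eventually.of_forall fun β => by
      rw [Real.norm_eq_abs, abs_of_nonneg (besselKappaIntegrand_nonneg d β)]; exact besselKappaIntegrand_le_div_four d β
  · -- dominated by 2/β² = 2 β^(-2) on (1, ∞)
    have hg : IntegrableOn (fun β : ℝ => 2 * β ^ (-2 : ℝ)) (Ioi 1) :=
      (integrableOn_Ioi_rpow_of_lt (by norm_num) zero_lt_one).const_mul 2
    refine hg.mono' (measurable_besselKappaIntegrand d).aestronglyMeasurable ?_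
    refine (ae_restrict_iff' measurableSet_Ioi).2 (Eventually.of_forall fun β hβ => ?_)
    have hβ0 : 0 < β := zero_lt_one.trans hβ
    rw [Real.norm_eq_abs, abs_of_nonneg (besselKappaIntegrand_nonneg d β), Real.rpow_neg hβ0.le, Real.rpow_two]
    simpa [div_eq_mul_inv] using besselKappaIntegrand_le_two_div_sq d β

/-- `0 ≤ ∫₀^∞(1 - J₀^d)/β²`. [cite: DLMF, 10.14.1] -/
theorem integral_Ioi_besselKappaIntegrand_nonneg : 0 ≤ ∫ β in Ioi 0, ((1 - besselJ 0 β ^ d) / β ^ 2) :=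
  setIntegral_nonneg measurableSet_Ioi fun β _ => besselKappaIntegrand_nonneg d β

/-- `∫_B^∞ β⁻² dβ = 1/B` (Mathlib's `integral_Ioi_rpow_of_lt`, restated with a natural power). [folklore] -/
private theorem integral_Ioi_one_div_sq {B : ℝ} (hB : 0 < B) : ∫ β in Ioi B, 1 / β ^ 2 = 1 / B := by
  have h := integral_Ioi_rpow_of_lt (a := -2) (by norm_num) hB
  have e : ∫ β in Ioi B, 1 / β ^ 2 = ∫ β in Ioi B, β ^ (-2 : ℝ) := by
    refine setIntegral_congr_fun measurableSet_Ioi fun β hβ => ?_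
    rw [Real.rpow_neg (hB.trans hβ).le, Real.rpow_two, one_div]
  rw [e, h]
  norm_num
  exact Real.rpow_neg_one B

/-- `0 ≤ η(B)` for `B > 0`. [cite: Iwaniec2002, Appendix B.4 (B.35), PDF p. 205] -/
theorem hankelEta_nonneg {B : ℝ} (hB : 0 < B) : 0 ≤ (Real.sqrt (2 / (π * B)) + 17 / B) := by positivity

/-- `|J₀(β)| ≤ η(B) = √(2/(πB)) + 17/B` for `β ≥ B > 0`. [cite: Iwaniec2002, Appendix B.4 (B.35), PDF p. 205] -/
theorem abs_besselJ_zero_le_hankelEta {B β : ℝ} (hB : 0 < B) (hβ : B ≤ β) : |besselJ 0 β| ≤ (Real.sqrt (2 / (π * B)) + 17 / B) := by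
  have hβ0 : 0 < β := hB.trans_le hβ
  have h := abs_besselJ_sub_hankel_le 0 hβ0
  have h17 : (17 : ℝ) * (1 + ((0 : ℕ) : ℝ) ^ 2) / β = 17 / β := by simp
  rw [h17] at h
  set M := Real.sqrt (2 / (π * β)) * Real.cos (β - ((0 : ℕ) : ℝ) * π / 2 - π / 4) with hM
  have hcos : |M| ≤ Real.sqrt (2 / (π * β)) := by
    rw [hM, abs_mul, abs_of_nonneg (Real.sqrt_nonneg _)]
    exact mul_le_of_le_one_right (Real.sqrt_nonneg _) (Real.abs_cos_le_one _)
  have htri : |besselJ 0 β| ≤ |besselJ 0 β - M| + |M| := by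
    have := abs_add_le (besselJ 0 β - M) M; simpa using this
  have h2 : Real.sqrt (2 / (π * β)) ≤ Real.sqrt (2 / (π * B)) :=
    Real.sqrt_le_sqrt (div_le_div_of_nonneg_left (by norm_num) (by positivity)
      (mul_le_mul_of_nonneg_left hβ pi_pos.le))
  have h3 : 17 / β ≤ 17 / B := div_le_div_of_nonneg_left (by norm_num) hB hβ
  linarith

/-- `β⁻²` is integrable on `(B, ∞)`, `B > 0`. [folklore] -/
private theorem integrableOn_one_div_sq {B : ℝ} (hB : 0 < B) : IntegrableOn (fun β : ℝ => 1 / β ^ 2) (Ioi B) :=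
  (integrableOn_Ioi_rpow_of_lt (a := -2) (by norm_num) hB).congr_fun
    (fun β hβ => by simp only; rw [Real.rpow_neg (hB.trans hβ).le, Real.rpow_two, one_div]) measurableSet_Ioi

/-- `J₀^d/β²` is integrable on `(B, ∞)`, `B > 0`. [cite: DLMF, 10.14.1] -/
theorem integrableOn_besselJ_zero_pow_div_sq {B : ℝ} (hB : 0 < B) :
    IntegrableOn (fun β => besselJ 0 β ^ d / β ^ 2) (Ioi B) := by
  have hJ : Continuous (besselJ 0) := continuous_besselJ_holds 0
  refine (integrableOn_one_div_sq hB).mono' ((by fun_prop : Measurable fun β => besselJ 0 β ^ d / β ^ 2)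
    |>.aestronglyMeasurable) ?_
  refine (ae_restrict_iff' measurableSet_Ioi).2 (Eventually.of_forall fun β hβ => ?_)
  have hβ0 : 0 < β := hB.trans hβ
  rw [norm_div, norm_pow, Real.norm_eq_abs, Real.norm_eq_abs, abs_of_pos (pow_pos hβ0 2)]
  exact div_le_div_of_nonneg_right (pow_le_one₀ (abs_nonneg _) (abs_besselJ_zero_le_one_holds β))
    (pow_pos hβ0 2).le

/-- `∫_B^∞ (1 - J₀^d)/β² = 1/B - ∫_B^∞ J₀^d/β²`. [cite: DLMF, 10.14.1] -/
theorem integral_Ioi_besselKappaIntegrand_eq {B : ℝ} (hB : 0 < B) :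
    ∫ β in Ioi B, ((1 - besselJ 0 β ^ d) / β ^ 2) = 1 / B - ∫ β in Ioi B, besselJ 0 β ^ d / β ^ 2 := by
  have e : ∀ β, ((1 - besselJ 0 β ^ d) / β ^ 2) = 1 / β ^ 2 - besselJ 0 β ^ d / β ^ 2 := fun β => by ring
  simp_rw [e]
  rw [integral_sub (integrableOn_one_div_sq hB) (integrableOn_besselJ_zero_pow_div_sq d hB),
    integral_Ioi_one_div_sq hB]

/-- `|∫_B^∞ J₀^d/β²| ≤ η(B)^d/B`. [cite: Iwaniec2002, Appendix B.4 (B.35), PDF p. 205] -/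
theorem abs_integral_Ioi_besselJ_zero_pow_div_sq_le {B : ℝ} (hB : 0 < B) :
    |∫ β in Ioi B, besselJ 0 β ^ d / β ^ 2| ≤ (Real.sqrt (2 / (π * B)) + 17 / B) ^ d / B := by
  calc |∫ β in Ioi B, besselJ 0 β ^ d / β ^ 2| ≤ ∫ β in Ioi B, |besselJ 0 β ^ d / β ^ 2| :=
        abs_integral_le_integral_abs
    _ ≤ ∫ β in Ioi B, (Real.sqrt (2 / (π * B)) + 17 / B) ^ d * (1 / β ^ 2) := by
        refine setIntegral_mono_on (integrableOn_besselJ_zero_pow_div_sq d hB).abs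
          ((integrableOn_one_div_sq hB).const_mul _) measurableSet_Ioi fun β hβ => ?_
        have hβ0 : 0 < β := hB.trans hβ
        rw [abs_div, abs_pow, abs_of_pos (pow_pos hβ0 2), ← div_eq_mul_one_div]
        exact div_le_div_of_nonneg_right
          (pow_le_pow_left₀ (abs_nonneg _) (abs_besselJ_zero_le_hankelEta hB hβ.le) d) (pow_pos hβ0 2).le
    _ = (Real.sqrt (2 / (π * B)) + 17 / B) ^ d / B := by rw [integral_const_mul, integral_Ioi_one_div_sq hB]; ring

/-- Splitting `∫₀^∞ = ∫₀^B + ∫_B^∞`. [cite: FitznerVanDerHofstad2016NoBLE, §5.1.1 (5.2)–(5.4)] -/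
theorem integral_Ioi_besselKappaIntegrand_eq_add {B : ℝ} (hB : 0 < B) :
    ∫ β in Ioi 0, ((1 - besselJ 0 β ^ d) / β ^ 2) = (∫ β in Ioc 0 B, ((1 - besselJ 0 β ^ d) / β ^ 2)) + ∫ β in Ioi B, ((1 - besselJ 0 β ^ d) / β ^ 2) := by
  rw [← Ioc_union_Ioi_eq_Ioi hB.le]
  exact setIntegral_union (disjoint_left.2 fun x hx hx' => not_lt.2 hx.2 hx') measurableSet_Ioi
    ((integrableOn_besselKappaIntegrand d).mono_set Ioc_subset_Ioi_self)
    ((integrableOn_besselKappaIntegrand d).mono_set (Ioi_subset_Ioi hB.le))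

/-- **THE TRUNCATION BRACKET**: `|∫₀^∞ (1 - J₀^d)/β² - (∫₀^B (1 - J₀^d)/β² + 1/B)| ≤ η(B)^d/B`,
`η(B) = √(2/(πB)) + 17/B` — the infinite-range Bessel integral for `κ_d` is the finite-range integral of an entire,
bounded (`≤ d/4`) integrand plus the explicit `1/B`, up to a tail error decaying like `B^{-1-d/2}`.
[cite: FitznerVanDerHofstad2016NoBLE, §5.1.1 (5.2)–(5.4); Iwaniec2002, Appendix B.4 (B.35), PDF p. 205] -/
theorem abs_integral_Ioi_besselKappaIntegrand_sub_le {B : ℝ} (hB : 0 < B) :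
    |(∫ β in Ioi 0, ((1 - besselJ 0 β ^ d) / β ^ 2)) - ((∫ β in Ioc 0 B, ((1 - besselJ 0 β ^ d) / β ^ 2)) + 1 / B)| ≤ (Real.sqrt (2 / (π * B)) + 17 / B) ^ d / B := by
  rw [integral_Ioi_besselKappaIntegrand_eq_add d hB, integral_Ioi_besselKappaIntegrand_eq d hB]
  have h := abs_integral_Ioi_besselJ_zero_pow_div_sq_le d hB
  rwa [show (∫ β in Ioc 0 B, ((1 - besselJ 0 β ^ d) / β ^ 2)) + (1 / B - ∫ β in Ioi B, besselJ 0 β ^ d / β ^ 2)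
      - ((∫ β in Ioc 0 B, ((1 - besselJ 0 β ^ d) / β ^ 2)) + 1 / B) = -∫ β in Ioi B, besselJ 0 β ^ d / β ^ 2 by ring, abs_neg]

/-- For EVEN `d` the tail is one-signed: `∫₀^∞ ≤ ∫₀^B + 1/B`. [cite: DLMF, 10.14.1] -/
theorem integral_Ioi_besselKappaIntegrand_le_of_even (hd : Even d) {B : ℝ} (hB : 0 < B) :
    ∫ β in Ioi 0, ((1 - besselJ 0 β ^ d) / β ^ 2) ≤ (∫ β in Ioc 0 B, ((1 - besselJ 0 β ^ d) / β ^ 2)) + 1 / B := by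
  rw [integral_Ioi_besselKappaIntegrand_eq_add d hB, integral_Ioi_besselKappaIntegrand_eq d hB]
  have : 0 ≤ ∫ β in Ioi B, besselJ 0 β ^ d / β ^ 2 :=
    setIntegral_nonneg measurableSet_Ioi fun β hβ => div_nonneg (hd.pow_nonneg _) (sq_nonneg β)
  linarith

/-- The truncated integral is a lower bound for every `d`: `∫₀^B ≤ ∫₀^∞`. [cite: DLMF, 10.14.1] -/
theorem integral_Ioc_besselKappaIntegrand_le {B : ℝ} (hB : 0 < B) :
    ∫ β in Ioc 0 B, ((1 - besselJ 0 β ^ d) / β ^ 2) ≤ ∫ β in Ioi 0, ((1 - besselJ 0 β ^ d) / β ^ 2) := by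
  rw [integral_Ioi_besselKappaIntegrand_eq_add d hB]
  have : 0 ≤ ∫ β in Ioi B, ((1 - besselJ 0 β ^ d) / β ^ 2) := setIntegral_nonneg measurableSet_Ioi fun β _ => besselKappaIntegrand_nonneg d β
  linarith

end KappaTail

section KappaCorollary

open Literature.Barriers.CriticalPhenomena
open Literature.Barriers.CriticalPhenomena.Slade2006Prop53 (P)

variable {d : ℕ}

/-- **`κ_d` BRACKET**: `|∫|D̂(k)|dk/(2π)^d − (2/(πd))(∫_{(0,B]}(1−J₀^d)β⁻²dβ + 1/B)| ≤ (2/(πd))·η(B)^d/B` for every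
`d ≥ 1`, `B > 0` (Part II's `integral_abs_Dhat_div_eq_integral_besselJ` + Part III's truncation bracket).
[cite: FitznerVanDerHofstad2016NoBLE, §5.1.1 (5.2)–(5.4); Iwaniec2002, Appendix B.4 (B.35), PDF p. 205] -/
theorem abs_integral_abs_Dhat_div_sub_le (hd : 0 < d) {B : ℝ} (hB : 0 < B) :
    |(∫ k, |Dhat d k| ∂P d) / (2 * π) ^ d
      - 2 / (π * d) * ((∫ β in Ioc 0 B, ((1 - besselJ 0 β ^ d) / β ^ 2)) + 1 / B)|
      ≤ 2 / (π * d) * ((Real.sqrt (2 / (π * B)) + 17 / B) ^ d / B) := by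
  rw [integral_abs_Dhat_div_eq_integral_besselJ hd]
  have h := abs_integral_Ioi_besselKappaIntegrand_sub_le d hB
  have hc : 0 < 2 / (π * d) := by positivity
  have e : (2 / (π * d) * ∫ β in Ioi (0:ℝ), (1 - besselJ 0 β ^ d) / β ^ 2)
      - 2 / (π * d) * ((∫ β in Ioc 0 B, ((1 - besselJ 0 β ^ d) / β ^ 2)) + 1 / B)
      = 2 / (π * d) * ((∫ β in Ioi 0, ((1 - besselJ 0 β ^ d) / β ^ 2))
          - ((∫ β in Ioc 0 B, ((1 - besselJ 0 β ^ d) / β ^ 2)) + 1 / B)) := by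
    ring
  rw [e, abs_mul, abs_of_pos hc]
  exact mul_le_mul_of_nonneg_left h hc.le

/-- The same bracket for the axis atom `K_{0,0}(e_i) = κ_d` (`srwK d 0 0 (Pi.single i 1)`).
[cite: FitznerVanDerHofstad2016NoBLE, (3.34)–(3.36) p. 1071; Iwaniec2002, Appendix B.4 (B.35), PDF p. 205] -/
theorem abs_srwK_zero_zero_single_sub_le (i : Fin d) {B : ℝ} (hB : 0 < B) :
    |srwK d 0 0 (Pi.single i 1)
      - 2 / (π * d) * ((∫ β in Ioc 0 B, ((1 - besselJ 0 β ^ d) / β ^ 2)) + 1 / B)|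
      ≤ 2 / (π * d) * ((Real.sqrt (2 / (π * B)) + 17 / B) ^ d / B) := by
  rw [srwK_zero_zero_single_eq_integral_besselJ i]
  have hd : 0 < d := Fin.pos i
  have h := abs_integral_Ioi_besselKappaIntegrand_sub_le d hB
  have hc : 0 < 2 / (π * d) := by positivity
  have e : (2 / (π * d) * ∫ β in Ioi (0:ℝ), (1 - besselJ 0 β ^ d) / β ^ 2)
      - 2 / (π * d) * ((∫ β in Ioc 0 B, ((1 - besselJ 0 β ^ d) / β ^ 2)) + 1 / B)
      = 2 / (π * d) * ((∫ β in Ioi 0, ((1 - besselJ 0 β ^ d) / β ^ 2))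
          - ((∫ β in Ioc 0 B, ((1 - besselJ 0 β ^ d) / β ^ 2)) + 1 / B)) := by
    ring
  rw [e, abs_mul, abs_of_pos hc]
  exact mul_le_mul_of_nonneg_left h hc.le

end KappaCorollary

section KappaCell

/-! ## Part IV — Lipschitz cells: a certified quadrature for `∫_{(0,B]} (1 − J₀^d)/β²` (KAPPA-CELL)

Part III (`abs_integral_abs_Dhat_div_sub_le`) reduces `∫ |D̂| dk/(2π)^d` to the proper
integral `∫_{(0,B]} f_d`, `f_d(β) = (1 − J₀(β)^d)/β²`, with an explicit tail error.  This
section certifies the simplest rigorous quadrature for that proper integral, uniformly in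
`d`: since `|J₀'| = |J₁| ≤ 1` [DLMF, 10.6.3 and 10.14.1], on `[a, ∞)` (`a > 0`) the integrand
is Lipschitz from the left node, `|f_d(β) − f_d(a)| ≤ (d/a² + 4/a³)(β − a)`, so the
left-endpoint rule on a cell `[a, b]` has error `≤ (d/a² + 4/a³)(b − a)²/2`; summed over an
arbitrary increasing grid `t₀ < t₁ < ⋯ < t_N` this gives
`|∫_{t₀}^{t_N} f_d − Σ_k (t_{k+1} − t_k) f_d(t_k)| ≤ Σ_k (d/t_k² + 4/t_k³)(t_{k+1} − t_k)²/2`,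
and the origin cell is enclosed by `0 ≤ ∫_{(0,a]} f_d ≤ (d/4)·a` (`f_d ≤ d/4`, Part III), with the
gluing `∫_{(0,B]} f_d = ∫_{(0,a]} f_d + ∫_a^B f_d`.  Together with interval values of `J₀` at the
(rational) nodes this is a complete, d-generic error budget for the bracket of Part III; no
number is asserted here.
-/

open Literature.Analysis.FunctionSpaces

variable (d : ℕ)

/-- `|J₀(x)^d − J₀(y)^d| ≤ d·|x − y|` (`|J₀| ≤ 1` and `J₀` is 1-Lipschitz since `J₀' = −J₁`, `|J₁| ≤ 1`;
the Lipschitz statement itself is `abs_besselJ_zero_sub_besselJ_zero_le` of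
`Literature/Analysis/FunctionSpaces/BesselJZeroSeriesRemainder.lean`, re-derived locally here).
[cite: DLMF, 10.6.3 and 10.14.1] -/
theorem abs_besselJ_zero_pow_sub_pow_le (x y : ℝ) :
    |besselJ 0 x ^ d - besselJ 0 y ^ d| ≤ d * |x - y| := by
  have hx : |besselJ 0 x| ≤ 1 := abs_besselJ_zero_le_one_holds x
  have hy : |besselJ 0 y| ≤ 1 := abs_besselJ_zero_le_one_holds y
  have hL : |besselJ 0 x - besselJ 0 y| ≤ |x - y| := by
    have hLip : LipschitzWith 1 (besselJ 0) := by
      refine lipschitzWith_of_nnnorm_deriv_le (fun z => (hasDerivAt_besselJ_zero_holds z).differentiableAt)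
        fun z => ?_
      rw [(hasDerivAt_besselJ_zero_holds z).deriv, ← NNReal.coe_le_coe, coe_nnnorm, Real.norm_eq_abs, abs_neg,
        NNReal.coe_one]
      exact abs_besselJ_one_le_one z
    have h := hLip.dist_le_mul x y
    simpa [Real.dist_eq] using h
  -- telescoping: `|u^n − v^n| ≤ n |u − v|` for `|u|, |v| ≤ 1`
  have key : ∀ n : ℕ, |besselJ 0 x ^ n - besselJ 0 y ^ n| ≤ n * |besselJ 0 x - besselJ 0 y| := by
    intro n
    induction n with
    | zero => simp
    | succ n ih =>
        have e : besselJ 0 x ^ (n + 1) - besselJ 0 y ^ (n + 1)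
            = besselJ 0 x * (besselJ 0 x ^ n - besselJ 0 y ^ n) + (besselJ 0 x - besselJ 0 y) * besselJ 0 y ^ n := by
          ring
        rw [e]
        have hyn : |besselJ 0 y| ^ n ≤ 1 := pow_le_one₀ (abs_nonneg _) hy
        calc |besselJ 0 x * (besselJ 0 x ^ n - besselJ 0 y ^ n) + (besselJ 0 x - besselJ 0 y) * besselJ 0 y ^ n|
            ≤ |besselJ 0 x * (besselJ 0 x ^ n - besselJ 0 y ^ n)| + |(besselJ 0 x - besselJ 0 y) * besselJ 0 y ^ n| :=
              abs_add_le _ _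
          _ = |besselJ 0 x| * |besselJ 0 x ^ n - besselJ 0 y ^ n| + |besselJ 0 x - besselJ 0 y| * |besselJ 0 y| ^ n := by
              rw [abs_mul, abs_mul, abs_pow]
          _ ≤ 1 * (n * |besselJ 0 x - besselJ 0 y|) + |besselJ 0 x - besselJ 0 y| * 1 := by
              gcongr
          _ = ((n + 1 : ℕ) : ℝ) * |besselJ 0 x - besselJ 0 y| := by push_cast; ring
  exact (key d).trans (mul_le_mul_of_nonneg_left hL (Nat.cast_nonneg _))

/-- KAPPA-CELL, pointwise: on `[a, ∞)`, `a > 0`, the `κ`-integrand is Lipschitz from the left node,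
`|f_d(β) − f_d(a)| ≤ (d/a² + 4/a³)(β − a)`. [cite: DLMF, 10.6.3 and 10.14.1] -/
theorem abs_besselKappaIntegrand_sub_le {a β : ℝ} (ha : 0 < a) (hab : a ≤ β) :
    |(1 - besselJ 0 β ^ d) / β ^ 2 - (1 - besselJ 0 a ^ d) / a ^ 2| ≤ (d / a ^ 2 + 4 / a ^ 3) * (β - a) := by
  have hβ : 0 < β := ha.trans_le hab
  have key : (1 - besselJ 0 β ^ d) / β ^ 2 - (1 - besselJ 0 a ^ d) / a ^ 2
      = (1 - besselJ 0 β ^ d) * (1 / β ^ 2 - 1 / a ^ 2) + (besselJ 0 a ^ d - besselJ 0 β ^ d) / a ^ 2 := by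
    field_simp
    ring
  have h1 : |1 - besselJ 0 β ^ d| ≤ 2 := by
    have hp : |besselJ 0 β ^ d| ≤ 1 := by
      rw [abs_pow]; exact pow_le_one₀ (abs_nonneg _) (abs_besselJ_zero_le_one_holds β)
    have := abs_sub (1 : ℝ) (besselJ 0 β ^ d)
    rw [abs_one] at this
    linarith
  have h2 : |1 / β ^ 2 - 1 / a ^ 2| ≤ 2 * (β - a) / a ^ 3 := by
    have hle : 1 / β ^ 2 ≤ 1 / a ^ 2 := by
      gcongr
    rw [abs_of_nonpos (sub_nonpos.2 hle), neg_sub, div_sub_div _ _ (by positivity) (by positivity),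
      div_le_div_iff₀ (by positivity) (by positivity)]
    have hba : 0 ≤ β - a := sub_nonneg.2 hab
    have h3 : 0 ≤ 2 * β ^ 2 - (β + a) * a := by nlinarith
    have hid : 2 * (β - a) * (β ^ 2 * a ^ 2) - (1 * a ^ 2 - β ^ 2 * 1) * a ^ 3
        = (β - a) * a ^ 2 * (2 * β ^ 2 - (β + a) * a) + 2 * (β ^ 2 - a ^ 2) * a ^ 3 := by ring
    nlinarith [mul_nonneg (mul_nonneg hba (sq_nonneg a)) h3, mul_nonneg (mul_nonneg hba (by positivity : (0:ℝ) ≤ β + a)) (pow_pos ha 3).le]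
  have h3 : |(besselJ 0 a ^ d - besselJ 0 β ^ d) / a ^ 2| ≤ d * (β - a) / a ^ 2 := by
    rw [abs_div, abs_of_pos (pow_pos ha 2)]
    gcongr
    calc |besselJ 0 a ^ d - besselJ 0 β ^ d| ≤ d * |a - β| := abs_besselJ_zero_pow_sub_pow_le d a β
      _ = d * (β - a) := by rw [abs_sub_comm, abs_of_nonneg (sub_nonneg.2 hab)]
  rw [key]
  calc |(1 - besselJ 0 β ^ d) * (1 / β ^ 2 - 1 / a ^ 2) + (besselJ 0 a ^ d - besselJ 0 β ^ d) / a ^ 2|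
      ≤ |(1 - besselJ 0 β ^ d) * (1 / β ^ 2 - 1 / a ^ 2)| + |(besselJ 0 a ^ d - besselJ 0 β ^ d) / a ^ 2| :=
        abs_add_le _ _
    _ = |1 - besselJ 0 β ^ d| * |1 / β ^ 2 - 1 / a ^ 2| + |(besselJ 0 a ^ d - besselJ 0 β ^ d) / a ^ 2| := by
        rw [abs_mul]
    _ ≤ 2 * (2 * (β - a) / a ^ 3) + d * (β - a) / a ^ 2 :=
        add_le_add (mul_le_mul h1 h2 (abs_nonneg _) (by norm_num)) h3
    _ = (d / a ^ 2 + 4 / a ^ 3) * (β - a) := by ring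

/-- interval integrability of the `κ`-integrand on cells inside `(0, ∞)`.
[cite: FitznerVanDerHofstad2016NoBLE, §5.1.1 (5.2)–(5.4)] -/
theorem intervalIntegrable_besselKappaIntegrand {a b : ℝ} (ha : 0 ≤ a) (hab : a ≤ b) :
    IntervalIntegrable (fun β : ℝ => (1 - besselJ 0 β ^ d) / β ^ 2) volume a b :=
  (intervalIntegrable_iff_integrableOn_Ioc_of_le hab).2
    ((integrableOn_besselKappaIntegrand d).mono_set fun _ hx => ha.trans_lt hx.1)

/-- KAPPA-CELL, one cell: the left-endpoint rule on `[a, b] ⊂ (0, ∞)` has error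
`≤ (d/a² + 4/a³)(b − a)²/2`. [cite: DLMF, 10.6.3 and 10.14.1] -/
theorem abs_integral_besselKappaIntegrand_sub_mul_le {a b : ℝ} (ha : 0 < a) (hab : a ≤ b) :
    |(∫ β in a..b, (1 - besselJ 0 β ^ d) / β ^ 2) - (b - a) * ((1 - besselJ 0 a ^ d) / a ^ 2)|
      ≤ (d / a ^ 2 + 4 / a ^ 3) * (b - a) ^ 2 / 2 := by
  set L : ℝ := d / a ^ 2 + 4 / a ^ 3 with hL
  have hint : IntervalIntegrable (fun β : ℝ => (1 - besselJ 0 β ^ d) / β ^ 2) volume a b :=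
    intervalIntegrable_besselKappaIntegrand d ha.le hab
  have h1 : (∫ β in a..b, (1 - besselJ 0 β ^ d) / β ^ 2) - (b - a) * ((1 - besselJ 0 a ^ d) / a ^ 2)
      = ∫ β in a..b, ((1 - besselJ 0 β ^ d) / β ^ 2 - (1 - besselJ 0 a ^ d) / a ^ 2) := by
    rw [intervalIntegral.integral_sub hint intervalIntegrable_const, intervalIntegral.integral_const, smul_eq_mul]
  rw [h1]
  have h2 : |∫ β in a..b, ((1 - besselJ 0 β ^ d) / β ^ 2 - (1 - besselJ 0 a ^ d) / a ^ 2)|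
      ≤ ∫ β in a..b, L * (β - a) := by
    refine (intervalIntegral.abs_integral_le_integral_abs hab).trans ?_
    refine intervalIntegral.integral_mono_on hab (hint.sub intervalIntegrable_const).abs
      ((continuous_const.mul (continuous_id.sub continuous_const)).intervalIntegrable _ _) fun β hβ => ?_
    exact abs_besselKappaIntegrand_sub_le d ha hβ.1
  have h3 : ∫ β in a..b, L * (β - a) = L * (b - a) ^ 2 / 2 := by
    have hi1 : IntervalIntegrable (fun x : ℝ => x) volume a b := continuous_id.intervalIntegrable a b
    have hi2 : IntervalIntegrable (fun _ : ℝ => a) volume a b := intervalIntegrable_const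
    rw [intervalIntegral.integral_const_mul, intervalIntegral.integral_sub hi1 hi2, integral_id,
      intervalIntegral.integral_const, smul_eq_mul]
    ring
  rw [h3] at h2
  exact h2

/-- KAPPA-CELL, composite: for any grid `0 < t 0 ≤ t 1 ≤ ⋯ ≤ t N`,
`|∫_{t 0}^{t N} f_d − Σ_{k<N} (t (k+1) − t k) f_d(t k)| ≤ Σ_{k<N} (d/(t k)² + 4/(t k)³)(t (k+1) − t k)²/2`.
[cite: DLMF, 10.6.3 and 10.14.1] -/
theorem abs_integral_besselKappaIntegrand_sub_sum_le (t : ℕ → ℝ) (N : ℕ) (h0 : 0 < t 0)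
    (hmono : ∀ k < N, t k ≤ t (k + 1)) :
    |(∫ β in t 0..t N, (1 - besselJ 0 β ^ d) / β ^ 2)
        - ∑ k ∈ Finset.range N, (t (k + 1) - t k) * ((1 - besselJ 0 (t k) ^ d) / (t k) ^ 2)|
      ≤ ∑ k ∈ Finset.range N, (d / t k ^ 2 + 4 / t k ^ 3) * (t (k + 1) - t k) ^ 2 / 2 := by
  have hpos : ∀ k, k ≤ N → 0 < t k := by
    intro k hk
    induction k with
    | zero => exact h0
    | succ k ih => exact (ih (Nat.le_of_succ_le hk)).trans_le (hmono k (Nat.lt_of_succ_le hk))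
  rw [← intervalIntegral.sum_integral_adjacent_intervals fun k hk =>
    intervalIntegrable_besselKappaIntegrand d (hpos k hk.le).le (hmono k hk), ← Finset.sum_sub_distrib]
  refine (Finset.abs_sum_le_sum_abs _ _).trans (Finset.sum_le_sum fun k hk => ?_)
  have hk' := Finset.mem_range.1 hk
  exact abs_integral_besselKappaIntegrand_sub_mul_le d (hpos k hk'.le) (hmono k hk')

/-- the origin cell: `0 ≤ ∫_{(0,a]} f_d ≤ (d/4)·a` (`0 ≤ f_d ≤ d/4`, Part III).
[cite: DLMF, 10.14.1] -/
theorem integral_Ioc_besselKappaIntegrand_mem_Icc {a : ℝ} (ha : 0 ≤ a) :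
    (∫ β in Ioc 0 a, (1 - besselJ 0 β ^ d) / β ^ 2) ∈ Icc (0 : ℝ) (d / 4 * a) := by
  have hint : IntegrableOn (fun β : ℝ => (1 - besselJ 0 β ^ d) / β ^ 2) (Ioc 0 a) :=
    (integrableOn_besselKappaIntegrand d).mono_set Ioc_subset_Ioi_self
  refine ⟨setIntegral_nonneg measurableSet_Ioc fun β _ => besselKappaIntegrand_nonneg d β, ?_⟩
  calc (∫ β in Ioc 0 a, (1 - besselJ 0 β ^ d) / β ^ 2) ≤ ∫ β in Ioc 0 a, (d : ℝ) / 4 :=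
        setIntegral_mono_on hint (integrableOn_const (hs := measure_Ioc_lt_top.ne)) measurableSet_Ioc
          fun β _ => besselKappaIntegrand_le_div_four d β
    _ = d / 4 * a := by
        rw [setIntegral_const, Real.volume_real_Ioc_of_le ha, smul_eq_mul]; ring

/-- gluing at the origin cell: `∫_{(0,B]} f_d = ∫_{(0,a]} f_d + ∫_a^B f_d` for `0 ≤ a ≤ B`.
[cite: FitznerVanDerHofstad2016NoBLE, §5.1.1 (5.2)–(5.4)] -/
theorem integral_Ioc_besselKappaIntegrand_eq_add_intervalIntegral {a B : ℝ} (ha : 0 ≤ a) (haB : a ≤ B) :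
    ∫ β in Ioc 0 B, (1 - besselJ 0 β ^ d) / β ^ 2
      = (∫ β in Ioc 0 a, (1 - besselJ 0 β ^ d) / β ^ 2) + ∫ β in a..B, (1 - besselJ 0 β ^ d) / β ^ 2 := by
  rw [← intervalIntegral.integral_of_le (ha.trans haB), ← intervalIntegral.integral_of_le ha,
    intervalIntegral.integral_add_adjacent_intervals (intervalIntegrable_besselKappaIntegrand d le_rfl ha)
      (intervalIntegrable_besselKappaIntegrand d ha haB)]

end KappaCell

section KappaCellBudget

open Literature.Analysis.FunctionSpaces
open Literature.Barriers.CriticalPhenomena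
open Literature.Barriers.CriticalPhenomena.Slade2006Prop53 (P)

variable {d : ℕ}

/-- **KAPPA-CELL, assembled error budget**: for every `d ≥ 1` and every increasing grid
`0 < t 0 ≤ t 1 ≤ ⋯ ≤ t N` (origin cell `(0, t 0]` enclosed by its midpoint value `(d/8)·t 0`,
truncation at `B = t N` with the Hankel tail of Part III),
`|∫|D̂|dk/(2π)^d − (2/(πd))·(Σ_{k<N}(t (k+1) − t k) f_d(t k) + (d/8) t 0 + 1/t N)|`
`≤ (2/(πd))·(Σ_{k<N}(d/(t k)² + 4/(t k)³)(t (k+1) − t k)²/2 + (d/8) t 0 + η(t N)^d/t N)`,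
`f_d(β) = (1 − J₀(β)^d)/β²`, `η(B) = √(2/(πB)) + 17/B`.  Every term on the right is explicit; with
interval values of `J₀` at the nodes this is a kernel-checkable enclosure recipe (no number asserted).
[cite: FitznerVanDerHofstad2016NoBLE, §5.1.1 (5.2)–(5.4); DLMF, 10.6.3 and 10.14.1; Iwaniec2002, Appendix B.4 (B.35)] -/
theorem abs_integral_abs_Dhat_div_sub_sum_le (hd : 0 < d) (t : ℕ → ℝ) (N : ℕ) (h0 : 0 < t 0)
    (hmono : ∀ k < N, t k ≤ t (k + 1)) :
    |(∫ k, |Dhat d k| ∂P d) / (2 * π) ^ d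
        - 2 / (π * d) * (∑ k ∈ Finset.range N, (t (k + 1) - t k) * ((1 - besselJ 0 (t k) ^ d) / (t k) ^ 2)
            + d / 8 * t 0 + 1 / t N)|
      ≤ 2 / (π * d) * (∑ k ∈ Finset.range N, (d / t k ^ 2 + 4 / t k ^ 3) * (t (k + 1) - t k) ^ 2 / 2
            + d / 8 * t 0 + (Real.sqrt (2 / (π * t N)) + 17 / t N) ^ d / t N) := by
  have hpos : ∀ k, k ≤ N → 0 < t k := by
    intro k hk
    induction k with
    | zero => exact h0
    | succ k ih => exact (ih (Nat.le_of_succ_le hk)).trans_le (hmono k (Nat.lt_of_succ_le hk))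
  have hle : ∀ k, k ≤ N → t 0 ≤ t k := by
    intro k hk
    induction k with
    | zero => exact le_rfl
    | succ k ih => exact (ih (Nat.le_of_succ_le hk)).trans (hmono k (Nat.lt_of_succ_le hk))
  have hB : 0 < t N := hpos N le_rfl
  have h3 := abs_integral_abs_Dhat_div_sub_le hd hB
  have hsplit := integral_Ioc_besselKappaIntegrand_eq_add_intervalIntegral d h0.le (hle N le_rfl)
  have hcell := abs_integral_besselKappaIntegrand_sub_sum_le d t N h0 hmono
  have horig := integral_Ioc_besselKappaIntegrand_mem_Icc d h0.le
  set c : ℝ := 2 / (π * d) with hc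
  have hc0 : 0 ≤ c := by positivity
  set K : ℝ := (∫ k, |Dhat d k| ∂P d) / (2 * π) ^ d with hK
  set I : ℝ := ∫ β in Ioc 0 (t N), (1 - besselJ 0 β ^ d) / β ^ 2 with hI
  set I0 : ℝ := ∫ β in Ioc 0 (t 0), (1 - besselJ 0 β ^ d) / β ^ 2 with hI0
  set Iab : ℝ := ∫ β in t 0..t N, (1 - besselJ 0 β ^ d) / β ^ 2 with hIab
  set S : ℝ := ∑ k ∈ Finset.range N, (t (k + 1) - t k) * ((1 - besselJ 0 (t k) ^ d) / (t k) ^ 2) with hS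
  set E : ℝ := ∑ k ∈ Finset.range N, (d / t k ^ 2 + 4 / t k ^ 3) * (t (k + 1) - t k) ^ 2 / 2 with hE
  set η : ℝ := (Real.sqrt (2 / (π * t N)) + 17 / t N) ^ d / t N with hη
  have hI0' : |I0 - d / 8 * t 0| ≤ d / 8 * t 0 := by
    rw [abs_le]; constructor <;> linarith [horig.1, horig.2]
  have key : K - c * (S + d / 8 * t 0 + 1 / t N) = (K - c * (I + 1 / t N)) + c * ((Iab - S) + (I0 - d / 8 * t 0)) := by
    rw [hsplit]; ring
  rw [key]
  calc |(K - c * (I + 1 / t N)) + c * ((Iab - S) + (I0 - d / 8 * t 0))|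
      ≤ |K - c * (I + 1 / t N)| + |c * ((Iab - S) + (I0 - d / 8 * t 0))| := abs_add_le _ _
    _ ≤ c * η + c * (E + d / 8 * t 0) := by
        refine add_le_add h3 ?_
        rw [abs_mul, abs_of_nonneg hc0]
        exact mul_le_mul_of_nonneg_left ((abs_add_le _ _).trans (add_le_add hcell hI0')) hc0
    _ = c * (E + d / 8 * t 0 + η) := by ring

end KappaCellBudget

end Literature.Probability.FitznerVanDerHofstad2017
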